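import Summits.Parity.BatemanHorn.Theses.RoughValueTransport
import Literature.NumberTheory.Sieve.BombieriAsymptoticSieveSmoothPart
import Literature.NumberTheory.Sieve.AletheiaZomleferFukshanskyGarcia2020Applications
import Summits.Parity.BatemanHorn.Theorems.RoughValueTransportRoughValueLawSieveBand
import Summits.Parity.BatemanHorn.Theorems.RoughValueTransportRoughValueLawFriableDecomposition
import Summits.Parity.BatemanHorn.Theorems.RoughValueTransportRoughValueLawTypeISumSwap
import Summits.Parity.BatemanHorn.Theorems.RoughValueTransportRoughValueLawCongruenceCount
import Summits.Parity.BatemanHorn.Theorems.RoughValueTransportRoughValueLawRieszMeanRootMoebius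
import Summits.Parity.BatemanHorn.Theorems.RoughValueTransportRoughValueLawRieszProductLimit
import Summits.Parity.BatemanHorn.Theorems.RoughValueTransportRoughValueLawSingularSeriesFactorisation
import Summits.Parity.BatemanHorn.Theorems.RoughValueTransportRoughValueLawOmegaFacts
import Summits.Parity.BatemanHorn.Theorems.RoughValueTransportSieveCalibration
import Summits.Parity.BatemanHorn.Theorems.RoughValueTransportRoughValueLawTypeILevelPush
import Literature.NumberTheory.Sieve.BuchstabLimitFact
import Literature.NumberTheory.LFunctions.PolynomialRootMoebiusSharpCutoff

/-!
# Line `friable-deep-tail` — checked skeleton for the crux `RoughValueLaw`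
(item stmt-Parity-11390, route `RoughValueTransport`, sub-problem Parity/BatemanHorn)

**v12 (line lead c12, `prover-line-stmt-Parity-11390-c12-0`, 2026-08-17; twelfth re-audit seat).**
Delta vs v11: the LEVER is PROVED.  The S4-slice `TypeILevelPushAt (X ^ 2 + 1)` (de-registered in v11 as
"blocked on the unlanded M0–M2 of HANDBACK-friable-deep-tail.md") is now the tree theorem
`typeILevelPush_X_sq_add_one` (`Theorems/RoughValueTransportRoughValueLawTypeILevelPush.lean`, p158572,
`--supports`; registered stub of that name, unfolded signature, defeq to the §1 def): M1 = Buchstab's law for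
the friable Möbius–root sum (c11, p154173), M2 = Iwaniec's level of distribution BEYOND `x` over friable moduli
(this seat: `Literature/NumberTheory/Sieve/FriableCellFactorisation|Partition|Counting`,
`IwaniecFriableLevelClasses`, `IwaniecFriableLevel` — p156481, p156983, p157016, p157361, p158177) and the landed
swap S2a give `typeISum_{X²+1}(u,1+δ;x)·log x/x → (𝔖/2)·u·ω((1+δ)u/2)` for `u ≥ 150`, `0 < δ ≤ 1/600`.
Consequences recorded in §2 (`typeILevelPushAt_X_sq_add_one`) and §5 (`deepTailBeyond_X_sq_add_one'`,
`largeDepthRoughValueLaw_X_sq_add_one'`, `deepTailBeyond_X_sq_add_one_of_pinnedLaw`): modulo PROVED pieces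
(S1 + the lever) the `n² + 1` rungs `u ≥ u₀` of the crux need ONLY the ε-parity statement
`DeepTailBeyond (X²+1)`, and the pinned law for `n²+1` gives it back — the sharp deep tail BEYOND `x` is the
exact open content of those rungs.  `sorry` still lives in EXACTLY ONE place, `stub_residual` (≡ the crux,
`residual_iff_roughValueLaw`); nothing used by `RoughValueLaw_of` was touched; the line verdict is unchanged
(`Lines/reaudit-c12-dead.md`).

**v11 (line lead c3, `prover-line-stmt-Parity-11390-c3-0`, 2026-08-17T02:40Z; second re-audit seat).**
Delta vs v10: the ORPHAN lever `stub_typeILevelPush_X_sq_add_one` (S4-slice: Type-I law for `n² + 1` at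
level `x^{1+δ}` over friable moduli) is DE-REGISTERED as a crux stub — its `sorry`d theorem is deleted, its
exact signature is kept below (§2, "Literature target") and its two §5 instances
(`deepTailBeyond_X_sq_add_one`, `largeDepthRoughValueLaw_X_sq_add_one`) now take
`TypeILevelPushAt (X ^ 2 + 1)` as a hypothesis.  Reason: it is not in the cone of `RoughValueLaw_of`
(audit class `orphan` in v8–v10), it is blocked on the unlanded M0–M2 of HANDBACK-friable-deep-tail.md,
and the crux strategist's decision 3 (STRATEGY-CENSUS.md §0) redirects it to `Literature/NumberTheory/Sieve/`
targets, not crux stubs.  After v11 the registered stub list is the honest one: `sorry` in EXACTLY ONE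
place, `stub_residual`, and `residual_iff_roughValueLaw : Residual ↔ RoughValueLaw` (§4d) is sorry-free
with axioms `[propext, Classical.choice, Quot.sound]` — the line has NO decomposition of the crux into
≥ 2 open load-bearing pieces; its one open stub is the crux (≥ Hardy–Littlewood prime k-tuples for degree
≤ 2: `Strength.batemanHornAsymptotic_of_roughValueLaw`, p108123).  No statement used by
`RoughValueLaw_of` was touched.

**v10 (line lead c2, `prover-line-stmt-Parity-11390-c2-0`, 2026-08-17; re-audit of the closed first-generation
lines).**  Delta vs v9 (lead a1): the LANDED stub `stub_singularSeriesFactorisation` (S2b₂β, p105661) is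
imported from `Theorems/RoughValueTransportRoughValueLawSingularSeriesFactorisation.lean` and its sorried
placeholder deleted.  Remaining `sorry`s = 2: `stub_residual` (≡ the crux: `residual_iff_roughValueLaw`,
§4d, kernel-checked; and the crux ⟹ `TwinPrimeConjecture`, `Strength.twinPrimeConjecture_of_roughValueLaw`,
p108123) and `stub_typeILevelPush_X_sq_add_one` (TRUE, size XL, ORPHAN w.r.t. `RoughValueLaw_of`).  No
statement was changed; nothing else was edited.  CONSEQUENCE: with β imported, §4d
`residual_iff_roughValueLaw : Residual ↔ RoughValueLaw` now has axiom closure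
`[propext, Classical.choice, Quot.sound]` (no `sorryAx`; `lean check --axioms`, 2026-08-17) — normal form
NF2 is an UNCONDITIONAL kernel-checked equivalence: the line's single load-bearing open stub IS the crux.

Crux (by name: `Summit.Parity.BatemanHorn.Theses.RoughValueTransport.RoughValueLaw`): for every
Bateman–Horn system `f = (f₀,…,f_{k−1})` and every `ω` with Buchstab's characterisation
(`ω = 1/u` on `[1,2]`, continuous on `[1,∞)`, `(uω)' = ω(u−1)` for `u > 2`) there is `A` with
`Φ_f(x,u)·(log x)^k/x → A·(uω(u))^k` for every `u > 2`, where
`Φ_f(x,u) = #{1 ≤ n ≤ x : ∀ i, fᵢ(n) > 0 and no prime p < ⌈x^{deg fᵢ/u}⌉ divides fᵢ(n)}`.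

## The line (idea card `Ideas/friable-deep-tail.md`; triage TRIAGE-r1-{1,2,3}: pass ×3)

Lever: split Legendre's identity COORDINATE-WISE AT A LEVEL `D`.  With `sᵢ(n)` the
`Bᵢ`-friable part of `fᵢ(n)` (`Bᵢ = ⌈x^{deg fᵢ/u}⌉`; tree `smoothPart`), roughness of all values is
`∏ᵢ [sᵢ(n) = 1] = Σ_{dᵢ ∣ sᵢ(n)} ∏ᵢ μ(dᵢ) = typeIKernel_D(s(n)) + deepKernel_D(s(n))`, the two
`f`-INDEPENDENT signed kernels collecting the divisor tuples with `∏ dᵢ ≤ D`, resp. `> D`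
(S1 `stub_friableDecomposition`; `deepKernel_D(s) = 0` unless `∏ sᵢ > D` — PROVED here,
`deepKernel_eq_zero_of_prod_le`, so the deep tail lives on the `n` whose values have an abnormally
large friable part, Tenenbaum's set, `deepSum_eq_sum_filter`).  Hence, at level `D = x^θ`,
`Φ_f = typeISum(θ) + deepSum(θ)` and the crux splits into
* the TYPE-I LAW `typeISum(θ)·(log x)^k/x → M_f(u,θ)` — for `θ < 1` every modulus is below the
  number of terms and the statement is a sharply-truncated sieve sum of dimension `k`, of
  prime-ideal-theorem strength (TRIAGE-r1-1/2/3: for `k = 1`, `deg f = d`,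
  `M_f(u,θ) = (C(f)/d)·u·ω(θu/d)·1[θu/d > 1]`, i.e. `λ(s) = e^γ ω(s)`, NOT "→ 1"; numerics
  `lambda_1e8.log`, kit j007750) — S2 `stub_typeILimit` (existence, all systems);
* the DEEP-TAIL LAW `deepSum(θ)·(log x)^k/x → (C(f)/∏ deg fᵢ)·(uω(u))^k − M_f(u,θ)` — the declared
  RESIDUAL S3 `stub_deepTailComplement` (open; parity-complete; for `k = 1` the target is
  `(C/d)·u·(ω(u) − ω(θu/d))`: −24 %, +6 %, −1 % of the rung of `n²+1` at `u = 3, 4, 6`, `θ = 0.95`);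
* the LEVEL PUSH (the card's Transfer (b), the genuinely new provable content): for ONE QUADRATIC
  `f` and `u ≥ u₀` the n-wise Type-I law persists BEYOND `x`, `typeISum(1+δ)·log x/x →
  (C(f)/2)·u·ω((1+δ)u/2)` for all `0 < δ ≤ δ₀(u)` — because a `x^{2/u}`-friable modulus factors at
  ANY prescribed scale (densely divisible), so the signed remainder `Σ_{x^{1−η}<d≤x^{1+δ}, P⁺(d)<z}
  μ(d) r_d(x)` is a sum of admissible bilinear forms: Iwaniec 1978 Cor. of Prop. 1 (level `x^{16/15}`
  for `n²+1`, PROVED in the tree as `Iwaniec1978.proposition1_corollary_holds`; `u₀ = 31`),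
  Merikoski 2022 Prop. 4 (i)+(ii) (`n²+1`, `u₀ = 6`), de la Bretèche–Drappeau / Iwaniec–Lemke Oliver
  dispersion for general quadratics (tree predicate `Iwaniec1978.proposition1G`) — S4
  `stub_typeILevelPush`.  Consistency check of the profile: at `θ = 2` (level = size of the values)
  `typeISum = Φ_f` identically and `(C/2)·u·ω(2u/2)` IS the crux's prediction with `A = C(f)/2`;
  so for a quadratic the crux ⟺ "the level law survives from `θ = 1+δ₀` to `θ = 2`", and the deep
  tail beyond `x` — the signed count over the `n ≤ x` whose value has a `x^{2/u}`-friable divisor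
  `> x^{1+δ}` (support density `ϑ(6, 3(1+δ)) ∈ [0.2 %, 1.2 %]` of the `n ≤ x`, size `|T| ≈ 0.5 %` of
  the rung, at `u = 6`) — is where the parity of the crux lives
  (`DeepTailBeyond`, PROVED here to follow from S1–S4 and to imply the crux's conclusion for `![f]`
  on the rungs `u ≥ u₀` with the forced constant `A = C(f)/2`).

## Reshape v2–v6 (line lead prover-line-stmt-Parity-11390-b-0, 2026-08-16) — 7 registered stubs (v6: taper of ORDER k)

* S1 and the new S2a/S2c are stated over TREE vocabulary only (`smoothPart`, `Nat.divisors`,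
  `Fintype.piFinset`, `ArithmeticFunction.moebius`, `Nat.primeFactors`, plain `Finset.filter`
  counts), i.e. with this file's §0 abbreviations UNFOLDED, so that each lands as a pure-proof
  `--supports` file without waiting for a reviewed Defs file; the §0 defs stay as this skeleton's
  reading vocabulary and the bridges are definitional (`friableDecomposition_iff` etc. by `Iff.rfl`).
* S2 `stub_typeILimit` is WEAKENED to the single level exponent the composition uses,
  `θ = θ_{k,u} = 1/((k+3)u)` (`thetaKU`; v2/v3 used `1/(k+3)`), and split one layer down into S2a
  `stub_typeISumSwap` (exact double-counting identity, M), S2c `stub_congruenceCount` (periodic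
  counting of the joint congruence classes, S/M) and S2b `stub_truncatedSingularSeries` (v4: the
  hyperbolically truncated singular series `S_f(D) = Σ_{∏dᵢ ≤ D} μ(d⃗)ρ_f(d⃗)/∏dᵢ` is
  `o((log D)^{-k})`, `k ≥ 1` — the prime-ideal-theorem-strength content, stated f-intrinsically
  with its limit `0` identified, L for `k = 1` from PROVED tree material, XL for `k ≥ 2`; held by
  the lead); at `θ_{k,u}` every remainder is absorbed by the TRIVIAL bounds `|T| ≤ D^k`,
  `ρ(d⃗) ≤ ∏dᵢ ≤ D`, `D^{k+1} ≤ x^{1/2}`, and the friability condition on the tuples is VACUOUS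
  (`D < x^{1/u} ≤ Bᵢ`), so no divisor-sum stub and no Buchstab iteration is needed.
  v3 (same session): the reduction `S2 ⇐ S2a + S2b + S2c` is kernel-checked here
  (`typeILimit_of_parts`, §4b), so S2 `stub_typeILimit` is NO LONGER A STUB — 6 registered stubs.
* S3 (residual, open) and S4 (lever, XL) are verbatim.

## Reshape v7/v8 (line lead prover-line-stmt-Parity-11390-1 — lineage 0, gen 1, continuation; 2026-08-16) — v8: ALL provable stubs LANDED (α p99246, β p105661, composition p101629); open: S3 ≡ crux, S4-slice blocked

* The LANDED stub S2b₁ (p84364) is IMPORTED from its Theorems file (same name, same namespace) and no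
  longer carries `sorry` here; the LANDED S1 (p80992), S2a (p81023), S2c (p81052) stay as `sorry`d stubs
  verbatim ONLY because the hub has not built their oleans yet (farm `remote:stale:unbuilt`, 2026-08-16T10:45Z);
  they are closed on the ledger and will be replaced by imports as soon as the modules are built.
* v6's S2b₂ `stub_rieszSingularSeries` (k ≥ 2, PIT strength in k fields) is SPLIT at the skeleton
  level into two independently landable stubs, both over Mathlib/tree vocabulary only and both
  provable now from PROVED tree material:
  S2b₂α `stub_rieszProductLimit` — pure real analysis: order-1 log-Riesz limits + sharp cut-off
  decay `C/log²x` for each of `k` arithmetic functions ⟹ the order-`k` log-Riesz mean of their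
  Dirichlet product converges (elementary induction, no rates, no complex analysis);
  S2b₂β `stub_singularSeriesFactorisation` — arithmetic: the joint-root-count coefficient
  `A_f = (∏ᵢ μρ_{fᵢ}) ⋆ E` with `Σ|E(m)|/m < ∞` (CRT, finitely many resultant primes,
  `ρᵢ(p) < p`).  §4c derives `RieszSingularLimit k` for EVERY `k` from them
  (`rieszSingularLimit_of_factorisation`: regrouping, reordering, Tannery), so v6's S2b₂ is the
  theorem `rieszSingularSeries_of_stubs` and S2 `TypeISmoothLimit` holds for all systems modulo
  S2b₂α/β (`typeISmoothLimit_of_stubs`).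
* S4 is NARROWED to its landable slice `f = X² + 1` (`stub_typeILevelPush_X_sq_add_one`; the
  drefuter showed the general-quadratic form leans on the unproved predicate
  `Iwaniec1978.proposition1G`); the general `TypeILevelPush` stays a `def`, hypothesis of the §5
  transfers (`deepTailBeyond_quadratic`, `largeDepthRoughValueLaw_quadratic`), and the `n² + 1`
  instances use the slice (`deepTailBeyond_X_sq_add_one`, `largeDepthRoughValueLaw_X_sq_add_one`).
* S3 `stub_residual` verbatim: THE RESIDUAL, held by the lead, never claimed.  NEW §4d (sorry-free
  glue): the crux pins its own constant (`pinnedLaw_of_roughValueLaw`, from the PROVED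
  `SieveCalibration`, de Bruijn's limit and uniqueness of Buchstab's ω), hence
  `residual_iff_roughValueLaw : Residual ↔ RoughValueLaw` — modulo S2 the residual IS the crux.
  Composition `RoughValueLaw_of` unchanged in shape: S2b₁ + S2b₂α + S2b₂β + (landed S2c) ⟹ S2;
  S2 + S3 ⟹ the crux BY NAME.

## v9 (line lead prover-line-stmt-Parity-11390-a1-0 — fourth lead, unit line-stmt-Parity-11390-a1; 2026-08-16T14:30Z) — honesty pass + verdict

* S1 (p80992), S2a (p81023), S2c (p81052) are now IMPORTED from their Theorems modules (oleans built);
  their verbatim `sorry`d copies are deleted.  `sorry` remains in exactly three places: β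
  `stub_singularSeriesFactorisation` (LANDED p105661, ACCEPTED 13:30Z, olean still unbuilt on the farm —
  a bookkeeping `sorry`, not an open stub), S3 `stub_residual` (open ≡ the crux) and S4
  `stub_typeILevelPush_X_sq_add_one` (true, orphan w.r.t. `RoughValueLaw_of`, blocked on the unlanded
  M1/M2 of HANDBACK-friable-deep-tail.md).
* VERDICT of this lead: the line is COMPLETE as a normal form and DEAD as a route to the crux.  Its one
  open crux-bearing stub S3 is `Residual ↔ RoughValueLaw` (§4d), and `RoughValueLaw` itself is now
  certified to be of Hardy–Littlewood strength by a kernel-checked theorem of this seat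
  (`Theorems/RoughValueTransportRoughValueLawStrength.lean`: with the other crux chain's PROVED
  `layerConclusion_of_natDegree_le_two`, the PROVED `sieveCalibration_proof` and the assembly squeeze,
  `RoughValueLaw → BatemanHornAsymptotic f` for EVERY Bateman–Horn system of degree `≤ 2`, hence
  `RoughValueLaw → TwinPrimeConjecture`, `→ HardyLittlewoodConjE`, `→ LandauConjecture`).  Nothing in
  this line's `Leans on:` (Type-I data at level `x^θ`, `θ < 1`; Iwaniec's bilinear level `x^{16/15}`
  for `n² + 1`; Landau–Riesz means; Buchstab–de Bruijn) supplies such a statement; see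
  `Lines/friable-deep-tail.dead.md`.

## Stubs (v1: 4) and composition

* S1 `stub_friableDecomposition` — the identity (Legendre per coordinate, split at `∏ dᵢ ≤ D`). [M,
  provable now]
* S2 `stub_typeILimit` — the level-`x^θ` (`θ < 1`) Type-I part of `Φ_f(x,u)` has a limit after the
  crux's normalisation, every BH system, every `u > 2`. [L for k = 1 / XL in general; PIT-strength]
* S3 `stub_deepTailComplement` — RESIDUAL (open): the deep tail converges to the complement
  `(C(f)/∏deg fᵢ)(uω(u))^k − M`. [open-problem; ≡ crux ∧ (A = C(f)/∏deg) modulo S1+S2 —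
  `deepTailComplement_of_pinnedLaw` / `systemRoughValueLaw_of_parts`, both PROVED here]
* S4 `stub_typeILevelPush` — THE LEVER: n-wise Type-I law beyond `x` for one BH quadratic, `u ≥ u₀`.
  [XL; provable now for `n²+1` from the tree's Iwaniec corollary + PIT for `ℚ(i)`] HARDEST CLAIMED.

Composition (sorry-free, kernel-checked): `RoughValueLaw_of : RoughValueLaw` from S1, S2, S3
(`systemRoughValueLaw_of_parts`, `roughValueLaw_iff`); beyond `x`: `deepTailBeyond_of_parts`
(S1–S4 ⇒ `DeepTailBeyond f`), `largeDepthRoughValueLaw_of_parts` (S1 + S4 + `DeepTailBeyond f` ⇒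
the crux's conclusion for `![f]`, `u ≥ u₀`, `A = C(f)/2`), `deepTailComplement_of_pinnedLaw`
(crux with the expected constant + S1 + S2 ⇒ S3: the residual is EXACTLY the crux's non-Type-I
content, no weakening and no strengthening beyond pinning `A`).

## Disproof.lean (cdisprove, 4 updates to 2026-08-15T22:52Z; body cited through its evidence notes —
not mounted in this jail, nothing landed under `Theorems/RoughValueLaw/Negative/`) — what is honoured

`roughValueLaw_false_without_nonAssociated` ((X,X)): S2/S3 carry `IsBatemanHornSystem f` and USE
`pairwise_not_associated` — for (X,X) the Type-I main term has dimension 1 against the `(log x)²`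
normalisation and diverges; `…_false_without_irreducible` ((X,X²)): S2 (the density `g(d⃗)` of the
Type-I sum is computed from irreducible, non-associated coordinates: common roots only at resultant
primes); `…_false_without_noFixedPrimeDivisor` with `conclusion_of_not_hasNoFixedPrimeDivisor`
(A = 0 allowed): consistent — a fixed prime divisor kills the Euler factor of the Type-I main term
and `C(f) = 0`; `…_false_without_omegaInit/omegaDDE`: S3 and S4 quantify over `ω` with the FULL
inline predicate (`IsBuchstab`, verbatim) and their targets name `ω(u)`, `ω((1+δ)u/2)`; continuity
clause redundant (`isBuchstab_iff`) — harmless, kept verbatim; `not_roughValueLawUniform`: no stub is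
uniform in `u` (S4's `δ₀` depends on `u`, and `x → ∞` first everywhere); rungs `tendsto_ratio_X`
(A = 1) and `conclusion_twoXAddOne` (A = 2 = C/deg) agree with the pinned constant
`bhA f = C(f)/∏ deg fᵢ` of S3/S4; `eventually_cardFactors_le_two`: S4 claims rungs `u ≥ u₀ ≥ 6`
only, never `u < 3`.  Negatives index (`ledger negatives --problem Parity`): 3 GHL items, none on
rough values; no stub is an instance of a refuted statement.
-/

noncomputable section

open Filter Finset Polynomial
open scoped Topology BigOperators

namespace Summit.Parity.BatemanHorn.Cruxes.RoughValueLaw.FriableDeepTail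

open Literature.NumberTheory.Sieve
open Summit.Parity.BatemanHorn.Theses.RoughValueTransport (RoughValueLaw)

/-! ## §0 Objects (all over existing declarations: `smoothPart`, `ArithmeticFunction.moebius`,
`Nat.divisors`, `Fintype.piFinset`, `IsBatemanHornSystem`, `batemanHornConst`) -/

/-- Buchstab's function, characterised INLINE exactly as in the crux (rev 4 cone repair): `ω = 1/u`
on `[1,2]`, continuous on `[1,∞)`, `(uω(u))' = ω(u−1)` for `u > 2`.  Unique solution: the tree's
`buchstabOmega` (existence/uniqueness machine-checked in the item's evidence OmegaUnique.lean). -/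
def IsBuchstab (ω : ℝ → ℝ) : Prop :=
  (∀ u : ℝ, 1 ≤ u → u ≤ 2 → ω u = u⁻¹) ∧ ContinuousOn ω (Set.Ici 1) ∧
    (∀ u : ℝ, 2 < u → HasDerivAt (fun t : ℝ => t * ω t) (ω (u - 1)) u)

/-- Sifting bound of coordinate `i` at height `x`, depth `u`: `Bᵢ = ⌈x^{deg fᵢ/u}⌉₊` (the crux sifts
the primes `p < Bᵢ`, i.e. `p ∈ range Bᵢ`). -/
def sieveBound {k : ℕ} (f : Fin k → ℤ[X]) (u : ℝ) (x : ℕ) (i : Fin k) : ℕ :=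
  ⌈(x : ℝ) ^ (((f i).natDegree : ℝ) / u)⌉₊

/-- The level `D = ⌊x^θ⌋₊` of the Type-I / deep split. -/
def level (θ : ℝ) (x : ℕ) : ℕ := ⌊(x : ℝ) ^ θ⌋₊

/-- The crux's count `Φ_f(x,u)` (verbatim sub-term of `RoughValueLaw`). -/
def roughCount {k : ℕ} (f : Fin k → ℤ[X]) (u : ℝ) (x : ℕ) : ℕ :=
  #((Icc 1 x).filter (fun n : ℕ => ∀ i, 0 < (f i).eval (n : ℤ) ∧
    ∀ p ∈ range ⌈(x : ℝ) ^ (((f i).natDegree : ℝ) / u)⌉₊, p.Prime → ¬ ((p : ℤ) ∣ (f i).eval (n : ℤ))))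

/-- Level-`D` **Type-I kernel** on a vector `s = (s₀,…,s_{k−1})` of positive integers:
`Σ_{d : dᵢ ∣ sᵢ, ∏ dᵢ ≤ D} ∏ᵢ μ(dᵢ)` — an `f`-independent signed combinatorial function. -/
def typeIKernel {k : ℕ} (D : ℕ) (s : Fin k → ℕ) : ℤ :=
  ∑ d ∈ (Fintype.piFinset fun i => (s i).divisors) with (∏ i, d i) ≤ D,
    ∏ i, (ArithmeticFunction.moebius (d i) : ℤ)

/-- Level-`D` **deep kernel** `h_D(s) = Σ_{d : dᵢ ∣ sᵢ, ∏ dᵢ > D} ∏ᵢ μ(dᵢ)` — the sharp-truncation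
remainder of the Legendre/Eratosthenes sieve written value-wise (TRIAGE-r1-2 (1)); `f`-independent;
vanishes unless `∏ sᵢ > D` (`deepKernel_eq_zero_of_prod_le`).  For `k = 1`:
`h_D(s) = −Σ_{d ∣ s, d ≤ D} μ(d)` when `s > D`, a truncated Möbius divisor sum. -/
def deepKernel {k : ℕ} (D : ℕ) (s : Fin k → ℕ) : ℤ :=
  ∑ d ∈ (Fintype.piFinset fun i => (s i).divisors) with D < ∏ i, d i,
    ∏ i, (ArithmeticFunction.moebius (d i) : ℤ)

/-- The vector of friable parts of the values at `n`: `sᵢ(n) =` the `Bᵢ`-friable part of `fᵢ(n)`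
(tree `smoothPart B N = ∏_{p ∣ N, p < B} p^{v_p(N)}`; `= 1` for `N = 0`). -/
def friableParts {k : ℕ} (f : Fin k → ℤ[X]) (B : Fin k → ℕ) (n : ℕ) : Fin k → ℕ :=
  fun i => smoothPart (B i) ((f i).eval (n : ℤ)).toNat

/-- The `1 ≤ n ≤ x` with every value positive (the crux's positivity clause; cofinite for a BH system). -/
def posRange {k : ℕ} (f : Fin k → ℤ[X]) (x : ℕ) : Finset ℕ :=
  (Icc 1 x).filter (fun n : ℕ => ∀ i, 0 < (f i).eval (n : ℤ))

/-- The level-`x^θ` **Type-I part** of `Φ_f(x,u)`: `Σ_{n} typeIKernel_{⌊x^θ⌋}(s(n))`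
(`= Σ_{∏dᵢ ≤ x^θ, dᵢ Bᵢ-friable} ∏μ(dᵢ)·#{n : dᵢ ∣ fᵢ(n) ∀ i}` after swapping sums). -/
def typeISum {k : ℕ} (f : Fin k → ℤ[X]) (u θ : ℝ) (x : ℕ) : ℤ :=
  ∑ n ∈ posRange f x, typeIKernel (level θ x) (friableParts f (sieveBound f u x) n)

/-- The level-`x^θ` **deep tail** of `Φ_f(x,u)`: `Σ_{n} deepKernel_{⌊x^θ⌋}(s(n))`, supported on the
`n` with `∏ᵢ sᵢ(n) > x^θ` (`deepSum_eq_sum_filter`). -/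
def deepSum {k : ℕ} (f : Fin k → ℤ[X]) (u θ : ℝ) (x : ℕ) : ℤ :=
  ∑ n ∈ posRange f x, deepKernel (level θ x) (friableParts f (sieveBound f u x) n)

/-- The crux's normalisation of `Φ_f`: `Φ_f(x,u)·(log x)^k/x`. -/
def roughNorm {k : ℕ} (f : Fin k → ℤ[X]) (u : ℝ) (x : ℕ) : ℝ :=
  (roughCount f u x : ℝ) * Real.log x ^ k / x

/-- Normalised Type-I part `typeISum·(log x)^k/x`. -/
def typeINorm {k : ℕ} (f : Fin k → ℤ[X]) (u θ : ℝ) (x : ℕ) : ℝ :=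
  (typeISum f u θ x : ℝ) * Real.log x ^ k / x

/-- Normalised deep tail `deepSum·(log x)^k/x`. -/
def deepNorm {k : ℕ} (f : Fin k → ℤ[X]) (u θ : ℝ) (x : ℕ) : ℝ :=
  (deepSum f u θ x : ℝ) * Real.log x ^ k / x

/-- The expected (and, modulo the route's provable-now support item SieveCalibration, forced)
constant of the crux: `A = C(f)/∏ᵢ deg fᵢ` (`C(f) = batemanHornConst f`; `= 1` for the empty
system, `= 1` for `(X)`, `= 2` for `(2X+1)` — the two rungs machine-checked in Disproof.lean). -/
def bhA {k : ℕ} (f : Fin k → ℤ[X]) : ℝ :=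
  batemanHornConst f / ∏ i, ((f i).natDegree : ℝ)


/-! ### §0b Vocabulary of the v2–v4 reshape (swapped Type-I sum) -/

/-- The level exponent the composition actually uses (v4): `θ = θ_{k,u} = 1/((k+3)u)`.  Two effects:
(i) every remainder of the swapped Type-I sum is trivially `o(x/(log x)^k)`
(`D^{k+1} ≤ x^{1/2}`); (ii) `D = ⌊x^θ⌋ < x^{1/u} ≤ ⌈x^{deg fᵢ/u}⌉`, so EVERY divisor tuple of the
Type-I sum is automatically friable and the density sum is the plain truncated singular series of
`f` (`truncSingularSum`), whose `(log)^k`-normalised limit is `0` for `k ≥ 1` (S2b). -/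
def thetaKU (k : ℕ) (u : ℝ) : ℝ := 1 / (((k : ℝ) + 3) * u)

/-- The divisor tuples of the level-`D` Type-I sum with sifting bounds `B`:
`T(B,D) = {d⃗ : 1 ≤ dᵢ ≤ D, ∏ dᵢ ≤ D, every prime factor of dᵢ is < Bᵢ}`. -/
def tupleSet {k : ℕ} (B : Fin k → ℕ) (D : ℕ) : Finset (Fin k → ℕ) :=
  (Fintype.piFinset fun _ : Fin k => Icc 1 D).filter
    (fun d => (∏ i, d i) ≤ D ∧ ∀ i, ∀ p ∈ (d i).primeFactors, p < B i)

/-- The same tuples WITHOUT the friability condition: `T⁰(D) = {d⃗ : 1 ≤ dᵢ ≤ D, ∏ dᵢ ≤ D}`. -/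
def tupleSet₀ (k : ℕ) (D : ℕ) : Finset (Fin k → ℕ) :=
  (Fintype.piFinset fun _ : Fin k => Icc 1 D).filter (fun d => (∏ i, d i) ≤ D)

/-- Joint congruence count with the crux's positivity clause:
`N⁺_f(d⃗; x) = #{1 ≤ n ≤ x : ∀ i, fᵢ(n) > 0 ∧ dᵢ ∣ fᵢ(n)}`. -/
def congCountPos {k : ℕ} (f : Fin k → ℤ[X]) (d : Fin k → ℕ) (x : ℕ) : ℕ :=
  #((Icc 1 x).filter (fun n : ℕ => (∀ i, 0 < (f i).eval (n : ℤ)) ∧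
    ∀ i, ((d i : ℕ) : ℤ) ∣ (f i).eval (n : ℤ)))

/-- Joint congruence count `N_f(d⃗; x) = #{1 ≤ n ≤ x : ∀ i, dᵢ ∣ fᵢ(n)}` (no positivity clause;
`∏ dᵢ`-periodic in `n`). -/
def congCount {k : ℕ} (f : Fin k → ℤ[X]) (d : Fin k → ℕ) (x : ℕ) : ℕ :=
  #((Icc 1 x).filter (fun n : ℕ => ∀ i, ((d i : ℕ) : ℤ) ∣ (f i).eval (n : ℤ)))

/-- Joint local root count `ρ_f(d⃗) = #{r mod ∏dᵢ : ∀ i, dᵢ ∣ fᵢ(r)}` (for a single coordinate and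
modulus `d` this is the tree's `polyRootCountMod ![f] d`). -/
def rhoTuple {k : ℕ} (f : Fin k → ℤ[X]) (d : Fin k → ℕ) : ℕ :=
  #((range (∏ i, d i)).filter (fun r : ℕ => ∀ i, ((d i : ℕ) : ℤ) ∣ (f i).eval (r : ℤ)))

/-- The density summand `μ(d⃗)·ρ_f(d⃗)/∏dᵢ` (reals). -/
def densityTerm {k : ℕ} (f : Fin k → ℤ[X]) (d : Fin k → ℕ) : ℝ :=
  (∏ i, (ArithmeticFunction.moebius (d i) : ℝ)) * (rhoTuple f d : ℝ) / (∏ i, ((d i : ℕ) : ℝ))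

/-- The density sum of the swapped Type-I part with sifting bounds `B`, level `D`:
`Σ_{d⃗ ∈ T(B,D)} μ(d⃗)ρ_f(d⃗)/∏dᵢ`. -/
def densitySum {k : ℕ} (f : Fin k → ℤ[X]) (B : Fin k → ℕ) (D : ℕ) : ℝ :=
  ∑ d ∈ tupleSet B D, densityTerm f d

/-- The **truncated singular series** of the system: `S_f(D) = Σ_{d⃗ ∈ T⁰(D)} μ(d⃗)ρ_f(d⃗)/∏dᵢ`
(hyperbolic truncation `∏ dᵢ ≤ D`, no friability).  Its complete version is the Euler product
`∏_p (1 − ν_f(p)/p) = 0` (`k ≥ 1`); S2b says the truncation error is `o((log D)^{-k})`. -/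
def truncSingularSum {k : ℕ} (f : Fin k → ℤ[X]) (D : ℕ) : ℝ :=
  ∑ d ∈ tupleSet₀ k D, densityTerm f d

/-! ### §0c Vocabulary of the v5 reshape (log-smoothed Type-I part) -/

/-- The logarithmic Riesz weight OF ORDER `k` (= the size of the system) of a divisor tuple at
level `D`: `w_D(d⃗) = (log(D/∏dᵢ)/log D)^k` (`∈ [0,1]` for `1 ≤ ∏dᵢ ≤ D`, `D ≥ 2`; junk for
`D < 2`).  Order `k` because the density Dirichlet series has a zero of order `k` at `s = 1`
(one `ζ_{Kᵢ}` per coordinate): the order-`k` Riesz mean is the one with a non-trivial limit and a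
Perron integrand of the classical shape (v6). -/
def rieszWeight {k : ℕ} (D : ℕ) (d : Fin k → ℕ) : ℝ :=
  (Real.log ((D : ℝ) / ((∏ i, d i : ℕ) : ℝ)) / Real.log D) ^ k

/-- The **log-smoothed Type-I part** of `Φ_f(x,u)` at level `D = ⌊x^{θ_{k,u}}⌋`, written directly
in swapped form: `Σ_{d⃗ ∈ T(B,D)} μ(d⃗)·w_D(d⃗)·N⁺_f(d⃗; x)` (n-wise it is
`Σ_n Σ_{d⃗ ∣ s(n), ∏dᵢ ≤ D} μ(d⃗) w_D(d⃗)`, the Legendre sum with the sharp cut-off `1[∏dᵢ ≤ D]`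
replaced by the logarithmic taper `log⁺(D/∏dᵢ)/log D`). -/
def typeISmooth {k : ℕ} (f : Fin k → ℤ[X]) (u : ℝ) (x : ℕ) : ℝ :=
  ∑ d ∈ tupleSet (sieveBound f u x) (level (thetaKU k u) x),
    (∏ i, (ArithmeticFunction.moebius (d i) : ℝ)) * rieszWeight (level (thetaKU k u) x) d *
      ((congCountPos f d x : ℕ) : ℝ)

/-- Its normalisation `typeISmooth·(log x)^k/x`. -/
def typeISmoothNorm {k : ℕ} (f : Fin k → ℤ[X]) (u : ℝ) (x : ℕ) : ℝ :=
  typeISmooth f u x * Real.log x ^ k / x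

/-- The **residual** of the line (v5): everything in `Φ_f` that is not the log-smoothed Type-I
part, `roughNorm − typeISmoothNorm`; by S1 it is the deep tail plus the taper correction
(`residualNorm_eq`). -/
def residualNorm {k : ℕ} (f : Fin k → ℤ[X]) (u : ℝ) (x : ℕ) : ℝ :=
  roughNorm f u x - typeISmoothNorm f u x

/-- The **order-`k` log-Riesz mean of the truncated singular series**:
`R_f(D) = Σ_{d⃗ ∈ T⁰(D)} μ(d⃗)ρ_f(d⃗)/∏dᵢ · log^k(D/∏dᵢ)` (`= k!·` the usual order-`k` Riesz mean). -/
def rieszSingularSum {k : ℕ} (f : Fin k → ℤ[X]) (D : ℕ) : ℝ :=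
  ∑ d ∈ tupleSet₀ k D, densityTerm f d * Real.log ((D : ℝ) / ((∏ i, d i : ℕ) : ℝ)) ^ k

/-! ## §1 Named statements of the line (the stubs restate them verbatim / unfolded; `DeepTailBeyond`,
`SystemRoughValueLaw`, `LargeDepthRoughValueLaw` are conclusions of the PROVED transfers) -/

/-- **FriableDecomposition** (= S1): the crux's count, for arbitrary sifting bounds `B` and level
`D`, equals sharp Type-I part plus deep tail, value-wise. -/
def FriableDecomposition : Prop :=
  ∀ (k : ℕ) (f : Fin k → ℤ[X]) (B : Fin k → ℕ) (D x : ℕ),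
    ((#((Icc 1 x).filter (fun n : ℕ => ∀ i, 0 < (f i).eval (n : ℤ) ∧
        ∀ p ∈ range (B i), p.Prime → ¬ ((p : ℤ) ∣ (f i).eval (n : ℤ)))) : ℕ) : ℤ) =
      ∑ n ∈ posRange f x, (typeIKernel D (friableParts f B n) + deepKernel D (friableParts f B n))

/-- **TypeISmoothLimit** (= S2, v5): the log-smoothed level-`x^{θ_{k,u}}` Type-I part converges
after normalisation (to `θ^{-k}·M_k(f)`: `typeISmoothLimit_of_parts`; `1` for `k = 0`). -/
def TypeISmoothLimit : Prop :=
  ∀ (k : ℕ) (f : Fin k → ℤ[X]), IsBatemanHornSystem f → ∀ u : ℝ, 2 < u →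
    ∃ M : ℝ, Tendsto (typeISmoothNorm f u) atTop (𝓝 M)

/-- **RieszSingularLimit k** (= S2b for `k`-systems): the order-`k` Riesz mean `R_f(D)` converges. -/
def RieszSingularLimit (k : ℕ) : Prop :=
  ∀ f : Fin k → ℤ[X], IsBatemanHornSystem f →
    ∃ M : ℝ, Tendsto (fun D : ℕ => rieszSingularSum f D) atTop (𝓝 M)

/-- **Residual** (= S3, v5, the RESIDUAL): whatever the smoothed Type-I limit `M` is, the residual
`roughNorm − typeISmoothNorm` converges to `(C(f)/∏deg fᵢ)·(uω(u))^k − M`. -/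
def Residual : Prop :=
  ∀ (k : ℕ) (f : Fin k → ℤ[X]), IsBatemanHornSystem f → ∀ ω : ℝ → ℝ, IsBuchstab ω →
    ∀ u : ℝ, 2 < u → ∀ M : ℝ, Tendsto (typeISmoothNorm f u) atTop (𝓝 M) →
      Tendsto (residualNorm f u) atTop (𝓝 (bhA f * (u * ω u) ^ k - M))

/-- **TypeILevelPush** (= S4, the LEVER): for one Bateman–Horn QUADRATIC `f` and `u ≥ u₀` the
n-wise (sharp) Type-I law holds at every level `x^{1+δ}`, `0 < δ ≤ δ₀(u)`, with the explicit limit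
`(C(f)/2)·u·ω((1+δ)u/2)`. -/
def TypeILevelPush : Prop :=
  ∀ f : ℤ[X], IsBatemanHornSystem ![f] → f.natDegree = 2 → ∀ ω : ℝ → ℝ, IsBuchstab ω →
    ∃ u₀ : ℝ, 2 < u₀ ∧ ∀ u : ℝ, u₀ ≤ u → ∃ δ₀ : ℝ, 0 < δ₀ ∧ ∀ δ : ℝ, 0 < δ → δ ≤ δ₀ →
      Tendsto (typeINorm ![f] u (1 + δ)) atTop (𝓝 (bhA ![f] * (u * ω ((1 + δ) * u / 2))))

/-- The lever AT one polynomial `f` (the `∀ ω …` body of `TypeILevelPush`; v7: the registered S4 is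
this statement at `f = X² + 1`). -/
def TypeILevelPushAt (f : ℤ[X]) : Prop :=
  ∀ ω : ℝ → ℝ, IsBuchstab ω →
    ∃ u₀ : ℝ, 2 < u₀ ∧ ∀ u : ℝ, u₀ ≤ u → ∃ δ₀ : ℝ, 0 < δ₀ ∧ ∀ δ : ℝ, 0 < δ → δ ≤ δ₀ →
      Tendsto (typeINorm ![f] u (1 + δ)) atTop (𝓝 (bhA ![f] * (u * ω ((1 + δ) * u / 2))))

/-- Read-back: `TypeILevelPush` is `TypeILevelPushAt` for every BH quadratic. -/
theorem typeILevelPush_iff :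
    TypeILevelPush ↔ ∀ f : ℤ[X], IsBatemanHornSystem ![f] → f.natDegree = 2 → TypeILevelPushAt f :=
  Iff.rfl

/-- **DeepTailBeyond f** — the residual AFTER the level push: for a quadratic `f`, the sharp deep
tail beyond `x` tends to `(C(f)/2)·u·(ω(u) − ω((1+δ)u/2))` after normalisation. -/
def DeepTailBeyond (f : ℤ[X]) : Prop :=
  ∀ ω : ℝ → ℝ, IsBuchstab ω →
    ∃ u₀ : ℝ, 2 < u₀ ∧ ∀ u : ℝ, u₀ ≤ u → ∃ δ₀ : ℝ, 0 < δ₀ ∧ ∀ δ : ℝ, 0 < δ → δ ≤ δ₀ →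
      Tendsto (deepNorm ![f] u (1 + δ)) atTop
        (𝓝 (bhA ![f] * (u * ω u - u * ω ((1 + δ) * u / 2))))

/-- The crux's conclusion for ONE system (verbatim body of `RoughValueLaw` after `IsBatemanHornSystem f →`). -/
def SystemRoughValueLaw (k : ℕ) (f : Fin k → ℤ[X]) : Prop :=
  ∀ ω : ℝ → ℝ, IsBuchstab ω → ∃ A : ℝ, ∀ u : ℝ, 2 < u →
    Tendsto (fun x : ℕ => (((Finset.Icc 1 x).filter (fun n : ℕ => ∀ i, 0 < (f i).eval (n : ℤ) ∧
      ∀ p ∈ Finset.range ⌈(x : ℝ) ^ (((f i).natDegree : ℝ) / u)⌉₊, p.Prime →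
        ¬ ((p : ℤ) ∣ (f i).eval (n : ℤ)))).card : ℝ) * Real.log x ^ k / (x : ℝ))
      atTop (𝓝 (A * (u * ω u) ^ k))

/-- The PINNED law for one system: the crux's conclusion with `A = C(f)/∏ deg fᵢ`, all `u > 2`. -/
def PinnedLaw {k : ℕ} (f : Fin k → ℤ[X]) : Prop :=
  ∀ ω : ℝ → ℝ, IsBuchstab ω → ∀ u : ℝ, 2 < u →
    Tendsto (roughNorm f u) atTop (𝓝 (bhA f * (u * ω u) ^ k))

/-- The crux's conclusion for one system ON THE RUNGS `u ≥ u₀`, with the pinned constant. -/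
def LargeDepthRoughValueLaw {k : ℕ} (f : Fin k → ℤ[X]) : Prop :=
  ∀ ω : ℝ → ℝ, IsBuchstab ω → ∃ u₀ : ℝ, ∀ u : ℝ, u₀ ≤ u →
    Tendsto (roughNorm f u) atTop (𝓝 (bhA f * (u * ω u) ^ k))

/-- Read-back: the crux is `∀ systems, SystemRoughValueLaw` (definitional, incl. the inline `ω`). -/
theorem roughValueLaw_iff :
    RoughValueLaw ↔ ∀ (k : ℕ) (f : Fin k → ℤ[X]), IsBatemanHornSystem f → SystemRoughValueLaw k f :=
  Iff.rfl

/-- `0 < θ_{k,u}` for `u > 0`. -/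
theorem thetaKU_pos (k : ℕ) {u : ℝ} (hu : 0 < u) : 0 < thetaKU k u := by
  unfold thetaKU; positivity

/-- `θ_{k,u} < 1/u` for `u > 0`. -/
theorem thetaKU_lt_inv (k : ℕ) {u : ℝ} (hu : 0 < u) : thetaKU k u < 1 / u := by
  unfold thetaKU
  rw [div_lt_div_iff_of_pos_left one_pos (by positivity) hu]
  have hk : (0 : ℝ) ≤ k := Nat.cast_nonneg k
  nlinarith

/-- `θ_{k,u} < 1` for `u > 2`. -/
theorem thetaKU_lt_one (k : ℕ) {u : ℝ} (hu : 2 < u) : thetaKU k u < 1 := by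
  have h := thetaKU_lt_inv k (show 0 < u by linarith)
  have : 1 / u < 1 := by rw [div_lt_one (by linarith)]; linarith
  linarith

/-- `(k+1)·θ_{k,u} ≤ 1/2` for `u > 2` (the remainder exponent). -/
theorem thetaKU_mul_succ_le (k : ℕ) {u : ℝ} (hu : 2 < u) : ((k : ℝ) + 1) * thetaKU k u ≤ 1 / 2 := by
  unfold thetaKU
  have hk : (0 : ℝ) ≤ k := Nat.cast_nonneg k
  have hpos : (0 : ℝ) < ((k : ℝ) + 3) * u := by positivity
  rw [← mul_div_assoc, mul_one, div_le_iff₀ hpos]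
  nlinarith

/-! ## §2 The stubs (`sorry` lives ONLY here) — v11: every provable stub LANDED; open = S3 alone (≡ crux); the S4-slice is de-registered (orphan, Literature target)

LANDED and IMPORTED (closed on the ledger; tree files under Theorems/, same names, same namespace):
S1 `stub_friableDecomposition` (p80992), S2a `stub_typeISumSwap` (p81023), S2c `stub_congruenceCount`
(p81052) — v9 (lead a1, 2026-08-16T14:30Z): their oleans are built, the verbatim `sorry`d copies are gone —,
and S2b₁ `stub_rieszMeanRootMoebius` (p84364).

S2b₂α `stub_rieszProductLimit` (analysis): LANDED p99246, IMPORTED.  S2b₂β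
`stub_singularSeriesFactorisation` (arithmetic): LANDED p105661 (sorry kept until its olean builds) — with α it gives
`RieszSingularLimit k` for EVERY `k` (§4c, kernel-checked; v6's single stub S2b₂
`stub_rieszSingularSeries` is now the THEOREM `rieszSingularSeries_of_stubs`); S3 `stub_residual`
(THE RESIDUAL ≡ pinned crux, open problem, held by the lead, never claimed); S4
`stub_typeILevelPush_X_sq_add_one` (the lever narrowed to its landable slice `f = X² + 1`, XL,
orphan w.r.t. the crux edge). -/

/- **S1 — FriableDecomposition: LANDED (p80992) and IMPORTED (v9)** from
`Summits/Parity/BatemanHorn/Theorems/RoughValueTransportRoughValueLawFriableDecomposition.lean`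
(`stub_friableDecomposition`, same name and namespace; statement registered, unchanged):
`#{1 ≤ n ≤ x : ∀ i, fᵢ(n) > 0 ∧ no prime p < Bᵢ divides fᵢ(n)} = Σ_{n ∈ posRange}
(typeIKernel_D + deepKernel_D)(s(n))`, `sᵢ(n) = smoothPart Bᵢ (fᵢ(n))` (Legendre per coordinate,
split at `∏ dᵢ ≤ D`; pure combinatorics, no hypothesis on `f`). -/

/- **S2a — TypeISumSwap: LANDED (p81023) and IMPORTED (v9)** from
`Summits/Parity/BatemanHorn/Theorems/RoughValueTransportRoughValueLawTypeISumSwap.lean`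
(`stub_typeISumSwap`): `Σ_{n ∈ posRange} typeIKernel_D(s(n)) = Σ_{d⃗ ∈ T(B,D)} (∏ᵢ μ(dᵢ)) · N⁺_f(d⃗; x)`. -/

/- **S2c — CongruenceCount: LANDED (p81052) and IMPORTED (v9)** from
`Summits/Parity/BatemanHorn/Theorems/RoughValueTransportRoughValueLawCongruenceCount.lean`
(`stub_congruenceCount`): `|#{1 ≤ n ≤ x : ∀ i, dᵢ ∣ fᵢ(n)} − x·ρ_f(d⃗)/∏dᵢ| ≤ ρ_f(d⃗)`. -/

/- **S2b₂α — RieszProductLimit: LANDED (p99246, worker w-alpha, 2026-08-16T11:21Z) and IMPORTED** from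
`Summits/Parity/BatemanHorn/Theorems/RoughValueTransportRoughValueLawRieszProductLimit.lean`
(`stub_rieszProductLimit`, 397 lines, log-coordinates + dominated convergence; helpers in the
sub-namespace `RieszProductLimit`).  Statement (registered, unchanged):
`∀ k (a : Fin k → ArithmeticFunction ℝ), (H1: order-1 log-Riesz limits of aᵢ(n)/n) →
(H2: |Σ_{n≤x} aᵢ(n)/n| ≤ Cᵢ/log²x for x ≥ 2) → ∃ M, Σ_{n≤x} (∏ᵢaᵢ)(n)/n·log(x/n)^k → M`. -/

/-! (v10: docstring of the LANDED stub, kept for the record)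
 **S2b₂β — SingularSeriesFactorisation (v7; ARITHMETIC; size L) — LANDED p105661 (worker w-beta,
2026-08-16T13:30Z; helpers p100917 `…SingularSeriesFactorisationEuler`, p101550
`…SingularSeriesFactorisationJoint`), kept here as a `sorry`d stub VERBATIM only until the hub builds
its olean (farm `unbuilt`), then: import + delete.**  For a Bateman–Horn system `f` of `k` polynomials, the joint coefficient
`A_f(n) := Σ_{d⃗ : dᵢ ∣ n, ∏dᵢ = n} μ(d⃗)·ρ_f(d⃗)`, `ρ_f(d⃗) = #{r < n : ∀ i, dᵢ ∣ fᵢ(r)}` (the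
joint root count modulo `∏dᵢ = n`), factors through the INDEPENDENT model
`B_f := ∏ᵢ μρ_{fᵢ}` (Dirichlet product of the single-coordinate functions
`n ↦ μ(n)ρ_{fᵢ}(n)`, `ρ_{fᵢ} = polyRootCountMod ![fᵢ]`): `A_f = B_f ⋆ E` with `Σ_m |E(m)|/m < ∞`.
Proof plan.  (1) Put `cᵢ(n) := ∏_{p^j ‖ n} ρ_{fᵢ}(p)^j` (`n ≥ 1`; `Nat.factorization.prod`), a
multiplicative arithmetic function with `μρ_{fᵢ} * cᵢ = 1` (both multiplicative —
`ArithmeticFunction.isMultiplicative_moebius`, `IsMultiplicative.pmul`/by hand with the tree's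
`polyRootCountMod_mul_of_coprime` (PolynomialCongruencesLemmas) — and equal on prime powers:
`(μρ*c)(p^j) = c(p^j) − ρ(p)c(p^{j−1}) = 0`, `IsMultiplicative.eq_iff_eq_on_prime_powers`), and
DEFINE `E := A_f * c₀ * ⋯ * c_{k−1}` (`A_f` as `toArithmeticFunction`); then
`B_f * E = A_f * ∏ᵢ(μρᵢ * cᵢ) = A_f` — the displayed identity (`ArithmeticFunction.mul_apply`); this
part needs NO hypothesis on `f`.  (2) `A_f` is multiplicative: for coprime `n', n''` the tuples with
`∏dᵢ = n'n''` are `dᵢ = d'ᵢd''ᵢ` with `∏d'ᵢ = n'`, `∏d''ᵢ = n''` (`d'ᵢ = gcd(dᵢ,n')`), `μ` splits, and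
the joint count splits by CRT: the predicate `∀ i, dᵢ ∣ fᵢ(r)` is the conjunction of an
`n'`-periodic and an `n''`-periodic predicate — tree `card_filter_range_mul_of_periodic`
(Summits…IsogenyRedeiTypeIMainTermLocalCounts) or `Nat.chineseRemainder`; hence `E` is
multiplicative and `E(p) = A_f(p) + Σᵢρᵢ(p)·(−1)·… = −Σᵢρᵢ(p) + Σᵢρᵢ(p) = 0`.  (3) Local bounds: write
`gᵢ = ρᵢ(p)`, `G = maxᵢ gᵢ ≤ p − 1` (`gᵢ ≤ ν_f(p) < p`: `hasNoFixedPrimeDivisor`, roots of `fᵢ` are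
roots of `∏fⱼ`), `d = max deg`.  `A_f(p^j) = (−1)^j Σ_{|S|=j} p^{j−1}ρ_S(p)` (`ρ_S(p)` = common roots
mod `p` of `{fᵢ : i ∈ S}`; tuples with two equal coordinates `p`… only `dᵢ ∈ {1,p,p²,…}` with
`μ ≠ 0` iff `dᵢ ∈ {1,p}`), so `A_f(p^j) = 0` for `j > k`, and for `|S| ≥ 2`, `ρ_S(p) = 0` unless `p`
divides the resultant-type integer `N_{ab} ≠ 0` of some pair `a ≠ b` (Bezout over `ℚ`: `f_a, f_b`
irreducible in `ℤ[X]` of positive degree are primitive — `Polynomial.Irreducible.isPrimitive`/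
`isUnit_or_eq_zero_of_isUnit_content` —, non-associated ⇒ coprime in `ℚ[X]`
(`EuclideanDomain`, `Irreducible.coprime_iff_not_dvd`, `IsPrimitive.dvd_iff_fraction_map_dvd`),
so `u f_a + v f_b = N_{ab}` with `u, v ∈ ℤ[X]`, `N_{ab} ∈ ℤ ∖ {0}` after clearing denominators):
FINITELY many bad primes.  Then `E(p^j) = Σ_{i ≤ min(j,k)} A_f(p^i)·h_{j−i}(g)` with `h` the complete
homogeneous symmetric polynomials (`1/∏(1−gᵢT) = Σ h_j T^j`), and `h_j − e₁h_{j−1} = −Σ_{i≥2}(−1)^i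
e_i h_{j−i}`, `e_i ≤ C(k)·e₂·G^{i−2}`, `h_j ≤ C(k,j)G^j` with `C(k,j)` polynomial in `j`, give
`|E(p^j)|/p^j ≤ P_k(j)·[(kd)²/p² + 1_{bad}(p)·kd/p]·(G/p)^{j−2}` — summable over `j ≥ 2` since
`G/p < 1`, with sum `≪ 1/p²` for good `p > 2kd`.  (4) Summability of `|E(m)|/m` from the local sums:
tree `summable_norm_of_summable_norm_prime_pow` + `prod_tsum_norm_prime_pow_le_exp`
(Literature…ArtinDirichletCoefficients; apply to `m ↦ (E m / m : ℂ)`), or Mathlib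
`EulerProduct.summable_and_hasSum_factoredNumbers_prod_filter_prime_tsum` directly.
Edges: `n = 0` (both sides `0`: `Nat.divisors 0 = ∅`, `divisorsAntidiagonal 0 = ∅`; for `k = 0` the
single empty tuple has product `1 ≠ 0`), `k = 0` (`A = B = 1 = δ₁`, `E = δ₁`), `k = 1` (`A = B`,
`E = δ₁`).  Numerically checked (lead, 2026-08-16): `B*E = A` exactly and `E(p) = 0` for all `p`,
`n ≤ 400`, systems `(X,X+2)`, `(X²+1,X+1)`, `(X²+1,(X+1)²+1)`, `(X²+1,X²+4)`.
Why needed: `R_f(D) = Σ_{m ≤ D} E(m)/m · G(D/m)` with `G` the order-`k` Riesz mean of `B_f`, so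
S2b₂α (at `aᵢ = μρ_{fᵢ}`: (H1) = tree `exists_tendsto_logRieszMean_moebius_rootCount`, (H2) = tree
`abs_sum_moebius_rootCount_div_le`) and dominated convergence give `RieszSingularLimit k` (§4c). -/
-- v10 (lead c2, 2026-08-17): the registered stub `stub_singularSeriesFactorisation` (S2b₂β) is
-- LANDED (p105661, `Theorems/RoughValueTransportRoughValueLawSingularSeriesFactorisation.lean`,
-- same namespace, verbatim signature) and is now IMPORTED; its sorried placeholder is deleted.
-- The uses below (`typeISmoothLimit_of_stubs`, §4c) resolve to the landed theorem.
/-- **S3 — Residual: THE RESIDUAL (v5 form; open problem; declared, not claimed).**  For a BH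
system `f`, Buchstab `ω`, `u > 2`: if the log-smoothed Type-I part tends to `M`, then the residual
`roughNorm − typeISmoothNorm` tends to `(C(f)/∏deg fᵢ)·(uω(u))^k − M`.  STATUS: given S2
(`TypeISmoothLimit`, derived here from S2b₁/S2b₂ + S2c) this is EQUIVALENT to the crux's
conclusion with the pinned constant `A = C(f)/∏deg fᵢ` for every system
(`residual_iff_pinnedLaw`, kernel-checked) — the crux's entire non-Type-I content, parity-complete
(`SelbergParityBarrier` bites; inside the `LinearSieveOptimality` window at every fixed `u`), of
Bateman–Horn / `P₂` strength on every rung `u ∈ (2,3)` (Disproof `eventually_cardFactors_le_two`).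
What it IS, n-wise (by S1 + the weighted swap): the deep tail `Σ_n h_D(s(n))` over Tenenbaum's set
`{n : ∏ sᵢ(n) > D}` PLUS the taper correction `Σ_n Σ_{d⃗ ∣ s(n), ∏dᵢ ≤ D} μ(d⃗)(1 − w_D(d⃗))`, both
`f`-independent kernels evaluated on the friable parts of the values.  Degree-1 single polynomials
(`aX+b`): provable now (Buchstab–de Bruijn in a progression; rungs `X`, `2X+1` machine-checked in
Disproof.lean).  Expected `A`: `bhA f`. -/
theorem stub_residual :
    ∀ (k : ℕ) (f : Fin k → ℤ[X]), IsBatemanHornSystem f → ∀ ω : ℝ → ℝ, IsBuchstab ω →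
      ∀ u : ℝ, 2 < u → ∀ M : ℝ, Tendsto (typeISmoothNorm f u) atTop (𝓝 M) →
        Tendsto (residualNorm f u) atTop (𝓝 (bhA f * (u * ω u) ^ k - M)) := by
  sorry

/-! **S4 — TypeILevelPush, NARROWED (v7) to its landable slice `f = X² + 1`: THE LEVER (size XL;
orphan w.r.t. the crux edge; not claimed this line; v11: no longer a registered stub — Literature target).**  For `f = X² + 1` and Buchstab `ω` there is
`u₀ > 2` such that for every `u ≥ u₀` and all `0 < δ ≤ δ₀(u)`:
`typeISum(1+δ)·log x/x → (𝔖/2)·u·ω((1+δ)u/2)` — the n-wise Type-I law BEYOND `x`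
(`bhA ![X²+1] = hardyLittlewoodEConst/2`).  v6 stated this for EVERY Bateman–Horn quadratic; the
drefuter (DREFUTE-friable-deep-tail.md, S4 (3b)) showed that form leans on the UNPROVED tree
predicate `Iwaniec1978.proposition1G` (general dispersion), whereas the `n² + 1` slice leans on
PROVED material only: `Iwaniec1978.proposition1_corollary_holds` (bilinear remainder, level
`x^{16/15}`, `u₀ = 31`, `δ₀(u) = 1/15 − 2/u − O(ε)`; cross-condition of the greedy friable
factorisation removable by grouping `P⁺` into short multiplicative intervals, drefute S4 (2)(ii)),
`Iwaniec1978.tendsto_densityProd_mul_log` (Mertens for `ρ_{n²+1}`), `isBatemanHornSystem_X_sq_add_one`.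
What is still MISSING for a proof (two L-size theorems, not in the tree): (M1) the main term
`G_f(z^s, z) := Σ_{d ≤ z^s, P⁺(d) < z} μ(d)ρ_f(d)/d ~ e^γ ω(s)·∏_{p<z}(1 − ρ_f(p)/p)` for fixed
`s > 1` (Buchstab recursion on `P⁺(d)` — same delay equation as for `Φ(y,z)/y`, initial range
`s ∈ (1,2]` from `Σ_d μ(d)ρ_f(d) log d/d = −C(f)·(residue)`, PIT depth; drefute S4 (1)); (M2) the
friable bilinear decomposition of `Σ_{x^{1−η} < d ≤ x^{1+δ}, P⁺(d) < z} μ(d) r_d(x)` into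
`O(log² x)` forms admissible for the Iwaniec corollary.  The general-quadratic statement
`TypeILevelPush` stays a `def` (hypothesis of the §5 transfers).  Consistency/edges as in v6
(NOT claimed for `deg f = 1` or `deg ≥ 3`, nor uniformly in `u`: `not_roughValueLawUniform`).

**v11 (lead c3, 2026-08-17): DE-REGISTERED as a crux stub** (orphan w.r.t. `RoughValueLaw_of`;
strategist decision 3: a `Literature/NumberTheory/Sieve/` target, not a crux stub).  Its registered
signature was, verbatim (namespace `…Cruxes.RoughValueLaw.FriableDeepTail`, = `TypeILevelPushAt (X ^ 2 + 1)`
unfolded, cf. `typeILevelPushAt_X_sq_add_one_iff` below):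

    theorem stub_typeILevelPush_X_sq_add_one :
        ∀ ω : ℝ → ℝ, IsBuchstab ω →
          ∃ u₀ : ℝ, 2 < u₀ ∧ ∀ u : ℝ, u₀ ≤ u → ∃ δ₀ : ℝ, 0 < δ₀ ∧ ∀ δ : ℝ, 0 < δ → δ ≤ δ₀ →
            Tendsto (typeINorm ![(X ^ 2 + 1 : ℤ[X])] u (1 + δ)) atTop
              (𝓝 (bhA ![(X ^ 2 + 1 : ℤ[X])] * (u * ω ((1 + δ) * u / 2))))

and the §5 instances for `n² + 1` take `TypeILevelPushAt (X ^ 2 + 1)` as a hypothesis instead. -/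

/-- Read-back (v11): the de-registered S4-slice is literally `TypeILevelPushAt (X ^ 2 + 1)`. -/
theorem typeILevelPushAt_X_sq_add_one_iff :
    TypeILevelPushAt (X ^ 2 + 1 : ℤ[X]) ↔
      ∀ ω : ℝ → ℝ, IsBuchstab ω →
        ∃ u₀ : ℝ, 2 < u₀ ∧ ∀ u : ℝ, u₀ ≤ u → ∃ δ₀ : ℝ, 0 < δ₀ ∧ ∀ δ : ℝ, 0 < δ → δ ≤ δ₀ →
          Tendsto (typeINorm ![(X ^ 2 + 1 : ℤ[X])] u (1 + δ)) atTop
            (𝓝 (bhA ![(X ^ 2 + 1 : ℤ[X])] * (u * ω ((1 + δ) * u / 2)))) :=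
  Iff.rfl

/-- **v12: the S4-slice is PROVED** — `TypeILevelPushAt (X² + 1)` is the landed lever
`typeILevelPush_X_sq_add_one` (`Theorems/RoughValueTransportRoughValueLawTypeILevelPush.lean`:
M1 + M2 + the swap S2a; `u₀ = 150`, `δ₀ = 1/600`), by definitional unfolding. -/
theorem typeILevelPushAt_X_sq_add_one : TypeILevelPushAt (X ^ 2 + 1 : ℤ[X]) :=
  typeILevelPush_X_sq_add_one

/-! ## §3 Localisation of the deep tail (sorry-free) -/

/-- The deep kernel vanishes unless the friable parts have product `> D` (`dᵢ ∣ sᵢ`, `sᵢ > 0` force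
`∏ dᵢ ≤ ∏ sᵢ`).  This is the card's "the parity of the rung lives on the abnormally friable values". -/
theorem deepKernel_eq_zero_of_prod_le {k : ℕ} {D : ℕ} {s : Fin k → ℕ}
    (hs : ∀ i, 0 < s i) (hD : ∏ i, s i ≤ D) : deepKernel D s = 0 := by
  unfold deepKernel
  refine Finset.sum_eq_zero fun d hd => ?_
  rw [Finset.mem_filter, Fintype.mem_piFinset] at hd
  exfalso
  have hle : ∏ i, d i ≤ ∏ i, s i :=
    Finset.prod_le_prod' fun i _ => Nat.le_of_dvd (hs i) (Nat.mem_divisors.mp (hd.1 i)).1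
  exact absurd (hd.2.trans_le (hle.trans hD)) (lt_irrefl _)

/-- Friable parts are positive (`smoothPart_ne_zero`). -/
theorem friableParts_pos {k : ℕ} (f : Fin k → ℤ[X]) (B : Fin k → ℕ) (n : ℕ) (i : Fin k) :
    0 < friableParts f B n i :=
  Nat.pos_of_ne_zero (smoothPart_ne_zero _ _)

/-- **Localisation**: the deep tail is a sum over Tenenbaum's "large friable component" set
`{n : ∏ᵢ sᵢ(n) > ⌊x^θ⌋}` only. -/
theorem deepSum_eq_sum_filter {k : ℕ} (f : Fin k → ℤ[X]) (u θ : ℝ) (x : ℕ) :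
    deepSum f u θ x =
      ∑ n ∈ (posRange f x).filter
          (fun n : ℕ => level θ x < ∏ i, friableParts f (sieveBound f u x) n i),
        deepKernel (level θ x) (friableParts f (sieveBound f u x) n) := by
  rw [deepSum, Finset.sum_filter_of_ne]
  intro n _ hne
  by_contra hle
  exact hne (deepKernel_eq_zero_of_prod_le (friableParts_pos f _ n) (not_lt.mp hle))

/-! ## §4 Composition (sorry-free): S2 + S3 ⟹ the crux BY NAME; S1/S2a/S2c bridges -/

/-- S1 at `B = sieveBound`, `D = level θ x`: `Φ_f(x,u) = typeISum(θ) + deepSum(θ)` (any `θ`). -/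
theorem roughCount_eq_typeISum_add_deepSum (h₁ : FriableDecomposition) {k : ℕ} (f : Fin k → ℤ[X])
    (u θ : ℝ) (x : ℕ) : (roughCount f u x : ℝ) = (typeISum f u θ x : ℝ) + (deepSum f u θ x : ℝ) := by
  have h : ((roughCount f u x : ℕ) : ℤ) = typeISum f u θ x + deepSum f u θ x := by
    rw [typeISum, deepSum, ← Finset.sum_add_distrib]
    exact h₁ k f (sieveBound f u x) (level θ x) x
  exact_mod_cast h

/-- Normalised form: `Φ_f·(log x)^k/x = typeINorm(θ) + deepNorm(θ)`. -/
theorem roughNorm_eq (h₁ : FriableDecomposition) {k : ℕ} (f : Fin k → ℤ[X]) (u θ : ℝ) (x : ℕ) :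
    roughNorm f u x = typeINorm f u θ x + deepNorm f u θ x := by
  rw [roughNorm, typeINorm, deepNorm, roughCount_eq_typeISum_add_deepSum h₁ f u θ x]
  ring

/-- The residual split is a tautology: `roughNorm = typeISmoothNorm + residualNorm`. -/
theorem roughNorm_eq_smooth_add_residual {k : ℕ} (f : Fin k → ℤ[X]) (u : ℝ) (x : ℕ) :
    roughNorm f u x = typeISmoothNorm f u x + residualNorm f u x := by
  rw [residualNorm]; ring

/-- **Transfer C⁺ ⟹ crux, system by system**: from the smoothed Type-I limit (S2) and the residual
(S3), the crux's conclusion holds for the system with `A = C(f)/∏ deg fᵢ`. -/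
theorem systemRoughValueLaw_of_parts (h₂ : TypeISmoothLimit) (h₃ : Residual) :
    ∀ (k : ℕ) (f : Fin k → ℤ[X]), IsBatemanHornSystem f → SystemRoughValueLaw k f := by
  intro k f hf ω hω
  refine ⟨bhA f, fun u hu => ?_⟩
  obtain ⟨M, hM⟩ := h₂ k f hf u hu
  have hT := h₃ k f hf ω hω u hu M hM
  have hsum := hM.add hT
  have hval : M + (bhA f * (u * ω u) ^ k - M) = bhA f * (u * ω u) ^ k := by ring
  rw [hval] at hsum
  refine hsum.congr fun x => ?_
  rw [← roughNorm_eq_smooth_add_residual f u x]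
  rfl

/-- **Honesty certificate**: given S2, the residual statement S3 is EQUIVALENT to the pinned law
for every Bateman–Horn system — it is RoughValueLaw with its constant identified, nothing weaker
and nothing stronger.  (A `promote-stub` of S3 hands back exactly the crux.) -/
theorem residual_iff_pinnedLaw (h₂ : TypeISmoothLimit) :
    Residual ↔ ∀ (k : ℕ) (f : Fin k → ℤ[X]), IsBatemanHornSystem f → PinnedLaw f := by
  constructor
  · intro h₃ k f hf ω hω u hu
    obtain ⟨M, hM⟩ := h₂ k f hf u hu
    have hsum := hM.add (h₃ k f hf ω hω u hu M hM)
    have hval : M + (bhA f * (u * ω u) ^ k - M) = bhA f * (u * ω u) ^ k := by ring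
    rw [hval] at hsum
    exact hsum.congr fun x => (roughNorm_eq_smooth_add_residual f u x).symm
  · intro hlaw k f hf ω hω u hu M hM
    have hlim := (hlaw k f hf ω hω u hu).sub hM
    exact hlim.congr fun x => by rw [residualNorm]

/-! ### Bridges from the registered (unfolded / specialised) stubs to the named statements -/

/-- S1 as registered (tree vocabulary) is DEFINITIONALLY the statement `FriableDecomposition`
(unfold `posRange`, `typeIKernel`, `deepKernel`, `friableParts`). -/
theorem friableDecomposition_iff :
    FriableDecomposition ↔
      ∀ (k : ℕ) (f : Fin k → ℤ[X]) (B : Fin k → ℕ) (D x : ℕ),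
        ((#((Icc 1 x).filter (fun n : ℕ => ∀ i, 0 < (f i).eval (n : ℤ) ∧
            ∀ p ∈ range (B i), p.Prime → ¬ ((p : ℤ) ∣ (f i).eval (n : ℤ)))) : ℕ) : ℤ) =
          ∑ n ∈ (Icc 1 x).filter (fun n : ℕ => ∀ i, 0 < (f i).eval (n : ℤ)),
            ((∑ d ∈ (Fintype.piFinset fun i =>
                  (smoothPart (B i) ((f i).eval (n : ℤ)).toNat).divisors) with (∏ i, d i) ≤ D,
                ∏ i, (ArithmeticFunction.moebius (d i) : ℤ)) +
             (∑ d ∈ (Fintype.piFinset fun i =>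
                  (smoothPart (B i) ((f i).eval (n : ℤ)).toNat).divisors) with D < ∏ i, d i,
                ∏ i, (ArithmeticFunction.moebius (d i) : ℤ))) :=
  Iff.rfl

/-- S1 (registered form) gives `FriableDecomposition`. -/
theorem friableDecomposition_of_stub : FriableDecomposition :=
  friableDecomposition_iff.mpr stub_friableDecomposition

/-- S2a as registered is DEFINITIONALLY the swap identity over this file's vocabulary:
`typeISum`-summand form `= Σ_{d⃗ ∈ tupleSet B D} (∏ μ(dᵢ)) · congCountPos f d⃗ x`. -/
theorem typeISumSwap_iff :
    (∀ (k : ℕ) (f : Fin k → ℤ[X]) (B : Fin k → ℕ) (D x : ℕ),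
        ∑ n ∈ posRange f x, typeIKernel D (friableParts f B n) =
          ∑ d ∈ tupleSet B D, (∏ i, (ArithmeticFunction.moebius (d i) : ℤ)) *
            ((congCountPos f d x : ℕ) : ℤ)) ↔
      ∀ (k : ℕ) (f : Fin k → ℤ[X]) (B : Fin k → ℕ) (D x : ℕ),
        (∑ n ∈ (Icc 1 x).filter (fun n : ℕ => ∀ i, 0 < (f i).eval (n : ℤ)),
            ∑ d ∈ (Fintype.piFinset fun i =>
                (smoothPart (B i) ((f i).eval (n : ℤ)).toNat).divisors) with (∏ i, d i) ≤ D,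
              ∏ i, (ArithmeticFunction.moebius (d i) : ℤ)) =
          ∑ d ∈ (Fintype.piFinset fun _ : Fin k => Icc 1 D) with
              ((∏ i, d i) ≤ D ∧ ∀ i, ∀ p ∈ (d i).primeFactors, p < B i),
            (∏ i, (ArithmeticFunction.moebius (d i) : ℤ)) *
              ((#((Icc 1 x).filter (fun n : ℕ => (∀ i, 0 < (f i).eval (n : ℤ)) ∧
                  ∀ i, ((d i : ℕ) : ℤ) ∣ (f i).eval (n : ℤ))) : ℕ) : ℤ) :=
  Iff.rfl

/-- The swapped form of the Type-I sum (from S2a): `typeISum f u θ x =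
Σ_{d⃗ ∈ tupleSet (sieveBound f u x) (level θ x)} (∏ μ(dᵢ)) · congCountPos f d⃗ x`. -/
theorem typeISum_eq_sum_tupleSet {k : ℕ} (f : Fin k → ℤ[X]) (u θ : ℝ) (x : ℕ) :
    typeISum f u θ x =
      ∑ d ∈ tupleSet (sieveBound f u x) (level θ x),
        (∏ i, (ArithmeticFunction.moebius (d i) : ℤ)) * ((congCountPos f d x : ℕ) : ℤ) :=
  (typeISumSwap_iff.mpr stub_typeISumSwap) k f (sieveBound f u x) (level θ x) x

/-- S2c as registered is DEFINITIONALLY `|congCount − x·rhoTuple/∏dᵢ| ≤ rhoTuple`. -/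
theorem congruenceCount_iff :
    (∀ (k : ℕ) (f : Fin k → ℤ[X]) (d : Fin k → ℕ) (x : ℕ), (∀ i, 0 < d i) →
        |((congCount f d x : ℕ) : ℝ) - (x : ℝ) * ((rhoTuple f d : ℕ) : ℝ) / ((∏ i, d i : ℕ) : ℝ)| ≤
          ((rhoTuple f d : ℕ) : ℝ)) ↔
      ∀ (k : ℕ) (f : Fin k → ℤ[X]) (d : Fin k → ℕ) (x : ℕ), (∀ i, 0 < d i) →
        |((#((Icc 1 x).filter (fun n : ℕ => ∀ i, ((d i : ℕ) : ℤ) ∣ (f i).eval (n : ℤ))) : ℕ) : ℝ) -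
            (x : ℝ) * ((#((range (∏ i, d i)).filter
                (fun r : ℕ => ∀ i, ((d i : ℕ) : ℤ) ∣ (f i).eval (r : ℤ))) : ℕ) : ℝ) /
              ((∏ i, d i : ℕ) : ℝ)| ≤
          ((#((range (∏ i, d i)).filter
              (fun r : ℕ => ∀ i, ((d i : ℕ) : ℤ) ∣ (f i).eval (r : ℤ))) : ℕ) : ℝ) :=
  Iff.rfl

/-- The congruence-class count (from S2c), named form. -/
theorem abs_congCount_sub_le {k : ℕ} (f : Fin k → ℤ[X]) (d : Fin k → ℕ) (x : ℕ)
    (hd : ∀ i, 0 < d i) :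
    |((congCount f d x : ℕ) : ℝ) - (x : ℝ) * ((rhoTuple f d : ℕ) : ℝ) / ((∏ i, d i : ℕ) : ℝ)| ≤
      ((rhoTuple f d : ℕ) : ℝ) :=
  (congruenceCount_iff.mpr stub_congruenceCount) k f d x hd

/-- With S1: the residual is the sharp deep tail plus the taper correction,
`residualNorm = deepNorm(θ) + (typeINorm(θ) − typeISmoothNorm)`, `θ = θ_{k,u}` — its n-wise meaning
(`deepSum_eq_sum_filter`: the deep tail lives on `{n : ∏ sᵢ(n) > D}`). -/
theorem residualNorm_eq (h₁ : FriableDecomposition) {k : ℕ} (f : Fin k → ℤ[X]) (u : ℝ) (x : ℕ) :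
    residualNorm f u x = deepNorm f u (thetaKU k u) x +
      (typeINorm f u (thetaKU k u) x - typeISmoothNorm f u x) := by
  rw [residualNorm, roughNorm_eq h₁ f u (thetaKU k u) x]
  ring

/-! ### §4b Reduction of S2 (`TypeISmoothLimit`) to S2b₁/S2b₂ + S2c — remainders trivial at `θ_{k,u}`

`typeISmooth = Σ_{d⃗ ∈ T} μ(d⃗) w_D(d⃗) N⁺(d⃗)`; `|μ w| ≤ 1` (`0 ≤ w_D ≤ 1` on `T`); `|N⁺ − N| ≤ n₀`;
`|N − xρ/∏d| ≤ ρ ≤ ∏d ≤ D` (S2c); `|T| ≤ D^k`; so `|typeISmooth − x·Σ_T μ w ρ/∏d| ≤ D^k (n₀ + D) ≤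
(n₀+1)√x`.  For `x ≥ 2` the friability in `T` is vacuous and `Σ_T μ w ρ/∏d = R_f(D)/log D`, so the
normalised main term is `(log x/log D)^k · R_f(D)(log D)^{k−1} → θ^{−k}·M` (`log D/log x → θ`). -/

/-- `|∏ μ(dᵢ)| ≤ 1`. -/
theorem abs_prod_moebius_le_one {k : ℕ} (d : Fin k → ℕ) :
    |(∏ i, (ArithmeticFunction.moebius (d i) : ℝ))| ≤ 1 := by
  rw [Finset.abs_prod]
  refine Finset.prod_le_one (fun i _ => abs_nonneg _) fun i _ => ?_
  have h := (ArithmeticFunction.abs_moebius_le_one (n := d i))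
  have : |((ArithmeticFunction.moebius (d i) : ℤ) : ℝ)| ≤ 1 := by exact_mod_cast h
  simpa using this

/-- `ρ_f(d⃗) ≤ ∏ dᵢ` (it counts residues below the modulus). -/
theorem rhoTuple_le_prod {k : ℕ} (f : Fin k → ℤ[X]) (d : Fin k → ℕ) :
    rhoTuple f d ≤ ∏ i, d i := by
  unfold rhoTuple
  exact (card_filter_le _ _).trans (card_range _).le

/-- `|tupleSet B D| ≤ D^k`. -/
theorem card_tupleSet_le {k : ℕ} (B : Fin k → ℕ) (D : ℕ) : #(tupleSet B D) ≤ D ^ k := by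
  unfold tupleSet
  refine (card_filter_le _ _).trans ?_
  rw [Fintype.card_piFinset, Finset.prod_const, Nat.card_Icc, Finset.card_univ, Fintype.card_fin]
  simp

/-- Members of `tupleSet B D` have `1 ≤ dᵢ` and `∏ dᵢ ≤ D`. -/
theorem mem_tupleSet {k : ℕ} {B : Fin k → ℕ} {D : ℕ} {d : Fin k → ℕ} (hd : d ∈ tupleSet B D) :
    (∀ i, 1 ≤ d i) ∧ (∏ i, d i) ≤ D := by
  unfold tupleSet at hd
  rw [mem_filter, Fintype.mem_piFinset] at hd
  exact ⟨fun i => (mem_Icc.mp (hd.1 i)).1, hd.2.1⟩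

/-- **Vacuous friability**: if `D < Bᵢ` for every `i`, then `tupleSet B D = tupleSet₀ k D` (every
prime factor of `dᵢ ≤ ∏ dⱼ ≤ D` is `< Bᵢ`). -/
theorem tupleSet_eq_tupleSet₀ {k : ℕ} {B : Fin k → ℕ} {D : ℕ} (h : ∀ i, D < B i) :
    tupleSet B D = tupleSet₀ k D := by
  unfold tupleSet tupleSet₀
  refine Finset.filter_congr fun d hd => ⟨fun hh => hh.1, fun hh => ⟨hh, fun i p hp => ?_⟩⟩
  rw [Fintype.mem_piFinset] at hd
  have hdi : d i ≤ D := (mem_Icc.mp (hd i)).2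
  exact lt_of_le_of_lt ((Nat.le_of_mem_primeFactors hp).trans hdi) (h i)

/-- Hence `densitySum f B D = truncSingularSum f D` when `D < Bᵢ` for all `i`. -/
theorem densitySum_eq_truncSingularSum {k : ℕ} (f : Fin k → ℤ[X]) {B : Fin k → ℕ} {D : ℕ}
    (h : ∀ i, D < B i) : densitySum f B D = truncSingularSum f D := by
  rw [densitySum, truncSingularSum, tupleSet_eq_tupleSet₀ h]

/-- The positivity clause costs at most `n₀`: `N(d⃗) ≤ N⁺(d⃗) + n₀` when every `fᵢ(n) > 0` for
`n ≥ n₀`. -/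
theorem congCount_le_congCountPos_add {k : ℕ} (f : Fin k → ℤ[X]) (d : Fin k → ℕ) (x : ℕ)
    {n₀ : ℕ} (hn₀ : ∀ i, ∀ n : ℕ, n₀ ≤ n → 0 < (f i).eval (n : ℤ)) :
    congCount f d x ≤ congCountPos f d x + n₀ := by
  unfold congCount congCountPos
  calc #((Icc 1 x).filter (fun n : ℕ => ∀ i, ((d i : ℕ) : ℤ) ∣ (f i).eval (n : ℤ)))
      ≤ #((Icc 1 x).filter (fun n : ℕ => (∀ i, 0 < (f i).eval (n : ℤ)) ∧
            ∀ i, ((d i : ℕ) : ℤ) ∣ (f i).eval (n : ℤ)) ∪ range n₀) := by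
        refine card_le_card fun n hn => ?_
        rw [mem_filter] at hn
        rw [mem_union, mem_filter, mem_range]
        by_cases h : n₀ ≤ n
        · exact Or.inl ⟨hn.1, fun i => hn₀ i n h, hn.2⟩
        · exact Or.inr (not_le.mp h)
    _ ≤ _ := (card_union_le _ _).trans (by rw [card_range])

/-- … and trivially `N⁺(d⃗) ≤ N(d⃗)`. -/
theorem congCountPos_le_congCount {k : ℕ} (f : Fin k → ℤ[X]) (d : Fin k → ℕ) (x : ℕ) :
    congCountPos f d x ≤ congCount f d x := by
  unfold congCount congCountPos
  exact card_le_card (fun n hn => by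
    rw [mem_filter] at hn ⊢
    exact ⟨hn.1, hn.2.2⟩)

/-- `0 ≤ w_D(d⃗) ≤ 1` for `d⃗ ∈ T(B,D)` (`1 ≤ ∏dᵢ ≤ D`; `D ≤ 1` gives base `0` by `log 1 = 0`). -/
theorem abs_rieszWeight_le_one {k : ℕ} {B : Fin k → ℕ} {D : ℕ} {d : Fin k → ℕ}
    (hd : d ∈ tupleSet B D) : |rieszWeight D d| ≤ 1 := by
  obtain ⟨hd1, hdD⟩ := mem_tupleSet hd
  have hP1 : 1 ≤ ∏ i, d i := Finset.one_le_prod' fun i _ => hd1 i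
  unfold rieszWeight
  rw [abs_pow]
  refine pow_le_one₀ (abs_nonneg _) ?_
  have hP : (1 : ℝ) ≤ ((∏ i, d i : ℕ) : ℝ) := by exact_mod_cast hP1
  have hPD : ((∏ i, d i : ℕ) : ℝ) ≤ (D : ℝ) := by exact_mod_cast hdD
  have hD1 : (1 : ℝ) ≤ D := hP.trans hPD
  have hlogD : 0 ≤ Real.log D := Real.log_nonneg hD1
  have hnum0 : 0 ≤ Real.log ((D : ℝ) / ((∏ i, d i : ℕ) : ℝ)) :=
    Real.log_nonneg ((one_le_div (by linarith)).mpr hPD)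
  have hnum1 : Real.log ((D : ℝ) / ((∏ i, d i : ℕ) : ℝ)) ≤ Real.log D := by
    rw [Real.log_div (by linarith) (by linarith)]
    linarith [Real.log_nonneg hP]
  rcases hlogD.eq_or_lt with h0 | hpos
  · rw [← h0, div_zero, abs_zero]; exact zero_le_one
  · rw [abs_of_nonneg (div_nonneg hnum0 hlogD), div_le_one hpos]
    exact hnum1

/-- The fixed-`x` remainder bound of the smoothed Type-I sum:
`|typeISmooth − x·Σ_T μ w ρ/∏d| ≤ D^k·(n₀ + D)`, `D = level θ_{k,u} x`. -/
theorem abs_typeISmooth_sub_le {k : ℕ} (f : Fin k → ℤ[X]) (u : ℝ) (x : ℕ) {n₀ : ℕ}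
    (hn₀ : ∀ i, ∀ n : ℕ, n₀ ≤ n → 0 < (f i).eval (n : ℤ)) :
    |typeISmooth f u x - (x : ℝ) *
        ∑ d ∈ tupleSet (sieveBound f u x) (level (thetaKU k u) x),
          (∏ i, (ArithmeticFunction.moebius (d i) : ℝ)) * rieszWeight (level (thetaKU k u) x) d *
            (((rhoTuple f d : ℕ) : ℝ) / ((∏ i, d i : ℕ) : ℝ))| ≤
      ((level (thetaKU k u) x : ℕ) : ℝ) ^ k * ((n₀ : ℝ) + (level (thetaKU k u) x : ℕ)) := by
  set D : ℕ := level (thetaKU k u) x with hD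
  set T := tupleSet (sieveBound f u x) D with hT
  rw [typeISmooth, ← hD, ← hT, Finset.mul_sum, ← Finset.sum_sub_distrib]
  have hpt : ∀ d ∈ T,
      |(∏ i, (ArithmeticFunction.moebius (d i) : ℝ)) * rieszWeight D d * ((congCountPos f d x : ℕ) : ℝ) -
          (x : ℝ) * ((∏ i, (ArithmeticFunction.moebius (d i) : ℝ)) * rieszWeight D d *
            (((rhoTuple f d : ℕ) : ℝ) / ((∏ i, d i : ℕ) : ℝ)))| ≤ (n₀ : ℝ) + D := by
    intro d hd
    obtain ⟨hd1, hdD⟩ := mem_tupleSet hd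
    have hdpos : ∀ i, 0 < d i := fun i => hd1 i
    have hμw : |(∏ i, (ArithmeticFunction.moebius (d i) : ℝ)) * rieszWeight D d| ≤ 1 := by
      rw [abs_mul]
      calc |∏ i, (ArithmeticFunction.moebius (d i) : ℝ)| * |rieszWeight D d| ≤ 1 * 1 :=
            mul_le_mul (abs_prod_moebius_le_one d) (abs_rieszWeight_le_one hd) (abs_nonneg _) zero_le_one
        _ = 1 := one_mul _
    have hN : |((congCountPos f d x : ℕ) : ℝ) -
        (x : ℝ) * ((rhoTuple f d : ℕ) : ℝ) / ((∏ i, d i : ℕ) : ℝ)| ≤ (n₀ : ℝ) + D := by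
      have h1 : |((congCountPos f d x : ℕ) : ℝ) - ((congCount f d x : ℕ) : ℝ)| ≤ n₀ := by
        have ha := congCount_le_congCountPos_add f d x hn₀
        have hb := congCountPos_le_congCount f d x
        rw [abs_sub_le_iff]
        constructor
        · have : ((congCountPos f d x : ℕ) : ℝ) ≤ ((congCount f d x : ℕ) : ℝ) := by exact_mod_cast hb
          linarith [(Nat.cast_nonneg n₀ : (0 : ℝ) ≤ n₀)]
        · have : ((congCount f d x : ℕ) : ℝ) ≤ ((congCountPos f d x : ℕ) : ℝ) + n₀ := by
            exact_mod_cast ha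
          linarith
      have h2 : |((congCount f d x : ℕ) : ℝ) -
          (x : ℝ) * ((rhoTuple f d : ℕ) : ℝ) / ((∏ i, d i : ℕ) : ℝ)| ≤ D := by
        refine (abs_congCount_sub_le f d x hdpos).trans ?_
        have := (rhoTuple_le_prod f d).trans hdD
        exact_mod_cast this
      calc |((congCountPos f d x : ℕ) : ℝ) - (x : ℝ) * ((rhoTuple f d : ℕ) : ℝ) / ((∏ i, d i : ℕ) : ℝ)|
          = |(((congCountPos f d x : ℕ) : ℝ) - ((congCount f d x : ℕ) : ℝ)) +
              (((congCount f d x : ℕ) : ℝ) -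
                (x : ℝ) * ((rhoTuple f d : ℕ) : ℝ) / ((∏ i, d i : ℕ) : ℝ))| := by ring_nf
        _ ≤ _ := abs_add_le _ _
        _ ≤ (n₀ : ℝ) + D := add_le_add h1 h2
    have hrw : (∏ i, (ArithmeticFunction.moebius (d i) : ℝ)) * rieszWeight D d *
          ((congCountPos f d x : ℕ) : ℝ) -
        (x : ℝ) * ((∏ i, (ArithmeticFunction.moebius (d i) : ℝ)) * rieszWeight D d *
          (((rhoTuple f d : ℕ) : ℝ) / ((∏ i, d i : ℕ) : ℝ))) =
        ((∏ i, (ArithmeticFunction.moebius (d i) : ℝ)) * rieszWeight D d) *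
          (((congCountPos f d x : ℕ) : ℝ) -
            (x : ℝ) * ((rhoTuple f d : ℕ) : ℝ) / ((∏ i, d i : ℕ) : ℝ)) := by ring
    rw [hrw, abs_mul]
    calc |(∏ i, (ArithmeticFunction.moebius (d i) : ℝ)) * rieszWeight D d| *
          |((congCountPos f d x : ℕ) : ℝ) - (x : ℝ) * ((rhoTuple f d : ℕ) : ℝ) / ((∏ i, d i : ℕ) : ℝ)|
        ≤ 1 * ((n₀ : ℝ) + D) := mul_le_mul hμw hN (abs_nonneg _) zero_le_one
      _ = (n₀ : ℝ) + D := one_mul _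
  refine (Finset.abs_sum_le_sum_abs _ _).trans ?_
  refine (Finset.sum_le_sum hpt).trans ?_
  rw [Finset.sum_const, nsmul_eq_mul]
  have hcard : (#T : ℝ) ≤ (D : ℝ) ^ k := by
    have := card_tupleSet_le (sieveBound f u x) D
    exact_mod_cast this
  have hnn : 0 ≤ (n₀ : ℝ) + D := by positivity
  exact mul_le_mul_of_nonneg_right hcard hnn

/-- The normalised remainder tends to zero at `θ = θ_{k,u}`, `u > 2`:
`D^k (n₀ + D) (log x)^k / x ≤ (n₀+1)(log x)^k/√x → 0`, `D = ⌊x^θ⌋`. -/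
theorem tendsto_remainder_zero (k n₀ : ℕ) {u : ℝ} (hu : 2 < u) :
    Tendsto (fun x : ℕ => ((level (thetaKU k u) x : ℕ) : ℝ) ^ k *
      ((n₀ : ℝ) + (level (thetaKU k u) x : ℕ)) * Real.log x ^ k / (x : ℝ)) atTop (𝓝 0) := by
  set θ : ℝ := thetaKU k u with hθdef
  have hθ : 0 < θ := thetaKU_pos k (by linarith)
  have hθk : ((k : ℝ) + 1) * θ ≤ 1 / 2 := thetaKU_mul_succ_le k hu
  have hlim : Tendsto (fun y : ℝ => ((n₀ : ℝ) + 1) * (Real.log y ^ k * y ^ (1 / 2 : ℝ) / y))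
      atTop (𝓝 0) := by
    have h := (isLittleO_log_rpow_rpow_atTop (k : ℝ) (by norm_num : (0 : ℝ) < 1 / 2)).tendsto_div_nhds_zero
    have h' : Tendsto (fun y : ℝ => Real.log y ^ k * y ^ (1 / 2 : ℝ) / y) atTop (𝓝 0) := by
      refine h.congr' ?_
      filter_upwards [eventually_gt_atTop (0 : ℝ)] with y hy
      have hs : y = y ^ (1 / 2 : ℝ) * y ^ (1 / 2 : ℝ) := by rw [← Real.rpow_add hy]; norm_num
      have hs0 : (0 : ℝ) < y ^ (1 / 2 : ℝ) := by positivity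
      rw [Real.rpow_natCast]
      conv_rhs => arg 2; rw [hs]
      rw [mul_div_mul_right _ _ hs0.ne']
    simpa using h'.const_mul ((n₀ : ℝ) + 1)
  have hnat := hlim.comp tendsto_natCast_atTop_atTop
  refine squeeze_zero' ?_ ?_ hnat
  · filter_upwards [eventually_ge_atTop 1] with x hx
    have hx0 : (0 : ℝ) < x := by exact_mod_cast hx
    positivity
  · filter_upwards [eventually_ge_atTop 1] with x hx
    have hx0 : (0 : ℝ) < x := by exact_mod_cast hx
    have hx1 : (1 : ℝ) ≤ x := by exact_mod_cast hx
    set D : ℕ := level θ x with hD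
    have hDle : (D : ℝ) ≤ (x : ℝ) ^ θ := by
      rw [hD, level]
      exact Nat.floor_le (by positivity)
    have hxθ1 : (1 : ℝ) ≤ (x : ℝ) ^ θ := Real.one_le_rpow hx1 hθ.le
    have h1 : (D : ℝ) ^ k * ((n₀ : ℝ) + D) ≤ ((n₀ : ℝ) + 1) * ((x : ℝ) ^ θ) ^ (k + 1) := by
      have hDk : (D : ℝ) ^ k ≤ ((x : ℝ) ^ θ) ^ k := pow_le_pow_left₀ (by positivity) hDle k
      have hnD : (n₀ : ℝ) + D ≤ ((n₀ : ℝ) + 1) * (x : ℝ) ^ θ := by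
        have : (n₀ : ℝ) ≤ (n₀ : ℝ) * (x : ℝ) ^ θ := le_mul_of_one_le_right (by positivity) hxθ1
        nlinarith
      calc (D : ℝ) ^ k * ((n₀ : ℝ) + D)
          ≤ ((x : ℝ) ^ θ) ^ k * (((n₀ : ℝ) + 1) * (x : ℝ) ^ θ) :=
            mul_le_mul hDk hnD (by positivity) (by positivity)
        _ = ((n₀ : ℝ) + 1) * ((x : ℝ) ^ θ) ^ (k + 1) := by ring
    -- `(x^θ)^{k+1} = x^{(k+1)θ} ≤ x^{1/2}`
    have h2 : ((x : ℝ) ^ θ) ^ (k + 1) ≤ (x : ℝ) ^ (1 / 2 : ℝ) := by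
      rw [← Real.rpow_natCast, ← Real.rpow_mul hx0.le]
      refine Real.rpow_le_rpow_of_exponent_le hx1 ?_
      push_cast
      linarith
    have hlog : 0 ≤ Real.log x ^ k := pow_nonneg (Real.log_nonneg hx1) k
    have H : (D : ℝ) ^ k * ((n₀ : ℝ) + D) ≤ ((n₀ : ℝ) + 1) * (x : ℝ) ^ (1 / 2 : ℝ) :=
      h1.trans (mul_le_mul_of_nonneg_left h2 (by positivity))
    calc (D : ℝ) ^ k * ((n₀ : ℝ) + D) * Real.log x ^ k / (x : ℝ)
        ≤ ((n₀ : ℝ) + 1) * (x : ℝ) ^ (1 / 2 : ℝ) * Real.log x ^ k / (x : ℝ) :=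
          div_le_div_of_nonneg_right (mul_le_mul_of_nonneg_right H hlog) hx0.le
      _ = ((n₀ : ℝ) + 1) * (Real.log x ^ k * (x : ℝ) ^ (1 / 2 : ℝ) / (x : ℝ)) := by ring
      _ = ((fun y : ℝ => ((n₀ : ℝ) + 1) * (Real.log y ^ k * y ^ (1 / 2 : ℝ) / y)) ∘
            (fun n : ℕ => (n : ℝ))) x := rfl

/-- The level `⌊x^θ⌋` tends to infinity (`θ > 0`). -/
theorem tendsto_level_atTop {θ : ℝ} (hθ : 0 < θ) : Tendsto (level θ) atTop atTop := by
  unfold level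
  exact tendsto_nat_floor_atTop.comp ((tendsto_rpow_atTop hθ).comp tendsto_natCast_atTop_atTop)

/-- Eventually in `x`, the level is below every sifting bound: `⌊x^{θ_{k,u}}⌋ < ⌈x^{deg fᵢ/u}⌉`
(`deg fᵢ ≥ 1`, `θ_{k,u} < 1/u`). -/
theorem eventually_level_lt_sieveBound {k : ℕ} {f : Fin k → ℤ[X]} (hf : IsBatemanHornSystem f)
    {u : ℝ} (hu : 2 < u) :
    ∀ᶠ x : ℕ in atTop, ∀ i, level (thetaKU k u) x < sieveBound f u x i := by
  have hu0 : 0 < u := by linarith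
  filter_upwards [eventually_ge_atTop 2] with x hx i
  have hx1 : (1 : ℝ) < x := by exact_mod_cast hx
  have hθ := thetaKU_lt_inv k hu0
  have hdeg : (1 : ℝ) / u ≤ ((f i).natDegree : ℝ) / u := by
    have : (1 : ℝ) ≤ (f i).natDegree := by exact_mod_cast hf.natDegree_pos i
    exact div_le_div_of_nonneg_right this hu0.le
  have hlt : (x : ℝ) ^ thetaKU k u < (x : ℝ) ^ (((f i).natDegree : ℝ) / u) :=
    Real.rpow_lt_rpow_of_exponent_lt hx1 (lt_of_lt_of_le hθ hdeg)
  unfold level sieveBound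
  have h1 : ((⌊(x : ℝ) ^ thetaKU k u⌋₊ : ℕ) : ℝ) ≤ (x : ℝ) ^ thetaKU k u :=
    Nat.floor_le (by positivity)
  have h2 : (x : ℝ) ^ (((f i).natDegree : ℝ) / u) ≤ ((⌈(x : ℝ) ^ (((f i).natDegree : ℝ) / u)⌉₊ : ℕ) : ℝ) :=
    Nat.le_ceil _
  exact_mod_cast lt_of_le_of_lt h1 (lt_of_lt_of_le hlt h2)

/-- Eventually `log x ≤ (2/θ)·log ⌊x^θ⌋` (`θ > 0`): the level has logarithm comparable to `log x`. -/
theorem eventually_log_le_mul_log_level {θ : ℝ} (hθ : 0 < θ) :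
    ∀ᶠ x : ℕ in atTop, Real.log x ≤ (2 / θ) * Real.log (level θ x) ∧ 0 < Real.log (level θ x) := by
  -- eventually `x^θ ≥ 4`, so `D ≥ x^θ − 1 ≥ x^θ/2 ≥ 2` and `log D ≥ θ log x − log 2 ≥ (θ/2) log x`
  have hev : ∀ᶠ x : ℕ in atTop, (4 : ℝ) ≤ (x : ℝ) ^ θ :=
    ((tendsto_rpow_atTop hθ).comp tendsto_natCast_atTop_atTop).eventually_ge_atTop 4
  filter_upwards [hev, eventually_ge_atTop 1] with x hx hx1
  have hx0 : (0 : ℝ) < x := by exact_mod_cast hx1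
  set D : ℕ := level θ x with hD
  have hDge : (x : ℝ) ^ θ / 2 ≤ (D : ℝ) := by
    have hfl : (x : ℝ) ^ θ - 1 < (D : ℝ) := by
      rw [hD, level]; exact Nat.sub_one_lt_floor _
    linarith
  have hD2 : (2 : ℝ) ≤ (D : ℝ) := by linarith
  have hDpos : (0 : ℝ) < D := by linarith
  have hlogD : Real.log ((x : ℝ) ^ θ / 2) ≤ Real.log D := Real.log_le_log (by positivity) hDge
  rw [Real.log_div (by positivity) (by norm_num), Real.log_rpow hx0] at hlogD
  have hlog2 : Real.log 2 ≤ θ * Real.log x / 2 := by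
    -- from `4 ≤ x^θ`: `log 4 = 2 log 2 ≤ θ log x`
    have h4 : Real.log 4 ≤ Real.log ((x : ℝ) ^ θ) := Real.log_le_log (by norm_num) hx
    rw [Real.log_rpow hx0] at h4
    have : Real.log 4 = 2 * Real.log 2 := by
      rw [show (4 : ℝ) = 2 ^ 2 by norm_num, Real.log_pow]; norm_num
    linarith
  constructor
  · have : θ * Real.log x / 2 ≤ Real.log D := by linarith
    rw [div_mul_eq_mul_div, le_div_iff₀ hθ]
    linarith
  · exact Real.log_pos (by linarith)

/-- **Vacuous friability + the taper**: for `D < Bᵢ` (all `i`),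
`Σ_{T(B,D)} μ w_D ρ/∏d = R_f(D)/(log D)^k`. -/
theorem weightedDensity_eq_rieszSingularSum_div {k : ℕ} (f : Fin k → ℤ[X]) {B : Fin k → ℕ}
    {D : ℕ} (h : ∀ i, D < B i) :
    ∑ d ∈ tupleSet B D, (∏ i, (ArithmeticFunction.moebius (d i) : ℝ)) * rieszWeight D d *
        (((rhoTuple f d : ℕ) : ℝ) / ((∏ i, d i : ℕ) : ℝ)) =
      rieszSingularSum f D / Real.log D ^ k := by
  rw [rieszSingularSum, tupleSet_eq_tupleSet₀ h, Finset.sum_div]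
  refine Finset.sum_congr rfl fun d _ => ?_
  rw [densityTerm, rieszWeight, div_pow]
  push_cast
  ring

/-- `log ⌊x^θ⌋ / log x → θ` (`θ > 0`). -/
theorem tendsto_log_level_div_log {θ : ℝ} (hθ : 0 < θ) :
    Tendsto (fun x : ℕ => Real.log (level θ x) / Real.log x) atTop (𝓝 θ) := by
  -- squeeze between `θ − log 2/log x` and `θ`
  have hlow : Tendsto (fun x : ℕ => θ - Real.log 2 / Real.log x) atTop (𝓝 θ) := by
    have h : Tendsto (fun x : ℕ => Real.log 2 / Real.log x) atTop (𝓝 0) :=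
      tendsto_const_nhds.div_atTop (Real.tendsto_log_atTop.comp tendsto_natCast_atTop_atTop)
    simpa using (tendsto_const_nhds (x := θ)).sub h
  have hev : ∀ᶠ x : ℕ in atTop, (4 : ℝ) ≤ (x : ℝ) ^ θ :=
    ((tendsto_rpow_atTop hθ).comp tendsto_natCast_atTop_atTop).eventually_ge_atTop 4
  refine tendsto_of_tendsto_of_tendsto_of_le_of_le' hlow tendsto_const_nhds ?_ ?_
  · filter_upwards [hev, eventually_ge_atTop 2] with x hx hx2
    have hx0 : (0 : ℝ) < x := by positivity
    have hx1 : (1 : ℝ) < x := by exact_mod_cast hx2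
    have hlogx : 0 < Real.log x := Real.log_pos hx1
    set D : ℕ := level θ x with hD
    have hDge : (x : ℝ) ^ θ / 2 ≤ (D : ℝ) := by
      have hfl : (x : ℝ) ^ θ - 1 < (D : ℝ) := by rw [hD, level]; exact Nat.sub_one_lt_floor _
      linarith
    have hDpos : (0 : ℝ) < D := by linarith
    have hlogD : θ * Real.log x - Real.log 2 ≤ Real.log D := by
      have := Real.log_le_log (by positivity) hDge
      rwa [Real.log_div (by positivity) (by norm_num), Real.log_rpow hx0] at this
    have key : θ - Real.log 2 / Real.log x = (θ * Real.log x - Real.log 2) / Real.log x := by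
      field_simp
    rw [key]
    exact div_le_div_of_nonneg_right hlogD hlogx.le
  · filter_upwards [eventually_ge_atTop 2] with x hx2
    have hx0 : (0 : ℝ) < x := by positivity
    have hx1 : (1 : ℝ) < x := by exact_mod_cast hx2
    have hlogx : 0 < Real.log x := Real.log_pos hx1
    set D : ℕ := level θ x with hD
    have hDle : (D : ℝ) ≤ (x : ℝ) ^ θ := by rw [hD, level]; exact Nat.floor_le (by positivity)
    rw [div_le_iff₀ hlogx]
    rcases Nat.eq_zero_or_pos D with h0 | hDpos
    · rw [h0]; simp only [Nat.cast_zero, Real.log_zero]; positivity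
    · have := Real.log_le_log (by exact_mod_cast hDpos) hDle
      rwa [Real.log_rpow hx0] at this

/-- `(log x / log ⌊x^θ⌋)^k → θ^{-k}` (`θ > 0`). -/
theorem tendsto_log_div_log_level_pow {θ : ℝ} (hθ : 0 < θ) (k : ℕ) :
    Tendsto (fun x : ℕ => (Real.log x / Real.log (level θ x)) ^ k) atTop (𝓝 ((1 / θ) ^ k)) := by
  have h := (tendsto_log_level_div_log hθ).inv₀ hθ.ne'
  have h' : Tendsto (fun x : ℕ => Real.log x / Real.log (level θ x)) atTop (𝓝 (1 / θ)) := by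
    refine (h.congr fun x => ?_).trans (by rw [one_div])
    rw [inv_div]
  exact h'.pow k

/-- S2b₁ (registered, k = 1, plain form) gives `RieszSingularLimit 1`. -/
theorem rieszSingularLimit_one
    (hS : ∀ (f : Fin 1 → ℤ[X]), IsBatemanHornSystem f →
      ∃ L : ℝ, Tendsto (fun D : ℕ => ∑ m ∈ Icc 1 D,
        (ArithmeticFunction.moebius m : ℝ) *
          ((#((range m).filter (fun r : ℕ => ((m : ℕ) : ℤ) ∣ (f 0).eval (r : ℤ))) : ℕ) : ℝ) /
            (m : ℝ) * Real.log ((D : ℝ) / m)) atTop (𝓝 L)) :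
    RieszSingularLimit 1 := by
  intro f hf
  obtain ⟨L, hL⟩ := hS f hf
  refine ⟨L, ?_⟩
  refine hL.congr fun D => ?_
  -- reindex the `Fin 1`-tuples by their single coordinate
  unfold rieszSingularSum tupleSet₀ densityTerm rhoTuple
  rw [Finset.sum_filter]
  rw [show (Fintype.piFinset fun _ : Fin 1 => Icc 1 D) = (Icc 1 D).map
      ⟨fun m : ℕ => fun _ : Fin 1 => m, fun a b h => by simpa using congrFun h 0⟩ by
    ext d
    simp only [Fintype.mem_piFinset, Finset.mem_map, Function.Embedding.coeFn_mk]
    constructor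
    · intro h; exact ⟨d 0, h 0, funext fun i => by rw [Subsingleton.elim i 0]⟩
    · rintro ⟨m, hm, rfl⟩ i; exact hm]
  rw [Finset.sum_map]
  refine Finset.sum_congr rfl fun m hm => ?_
  have hm1 : 1 ≤ m := (mem_Icc.mp hm).1
  simp only [Function.Embedding.coeFn_mk, Fin.prod_univ_one, Fin.forall_fin_one,
    (mem_Icc.mp hm).2, if_true, pow_one]

/-- S2b₂ (registered, unfolded) is DEFINITIONALLY `RieszSingularLimit k` for `k ≥ 2`. -/
theorem rieszSingularSeries_iff :
    (∀ (k : ℕ) (f : Fin k → ℤ[X]), IsBatemanHornSystem f → 2 ≤ k →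
        ∃ M : ℝ, Tendsto (fun D : ℕ => rieszSingularSum f D) atTop (𝓝 M)) ↔
      ∀ (k : ℕ) (f : Fin k → ℤ[X]), IsBatemanHornSystem f → 2 ≤ k →
        ∃ M : ℝ, Tendsto (fun D : ℕ =>
          ∑ d ∈ (Fintype.piFinset fun _ : Fin k => Icc 1 D) with (∏ i, d i) ≤ D,
            (∏ i, (ArithmeticFunction.moebius (d i) : ℝ)) *
                ((#((range (∏ i, d i)).filter
                    (fun r : ℕ => ∀ i, ((d i : ℕ) : ℤ) ∣ (f i).eval (r : ℤ))) : ℕ) : ℝ) /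
                (∏ i, ((d i : ℕ) : ℝ)) *
              Real.log ((D : ℝ) / ((∏ i, d i : ℕ) : ℝ)) ^ k) atTop (𝓝 M) :=
  Iff.rfl

/-- The smoothed density sum of the EMPTY system is `1` (for `D ≥ 1`). -/
theorem weightedDensity_fin_zero (f : Fin 0 → ℤ[X]) {B : Fin 0 → ℕ} {D : ℕ} (hD : 1 ≤ D) :
    ∑ d ∈ tupleSet B D, (∏ i, (ArithmeticFunction.moebius (d i) : ℝ)) * rieszWeight D d *
        (((rhoTuple f d : ℕ) : ℝ) / ((∏ i, d i : ℕ) : ℝ)) = 1 := by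
  unfold tupleSet rieszWeight rhoTuple
  simp [Fintype.piFinset_of_isEmpty, Finset.filter_true_of_mem, hD]

/-- **The smoothed density sum along the composition's level tends to a limit**
(`θ^{-k}·M` for `k ≥ 1` by S2b₁/S2b₂, `1` for `k = 0`), after the crux's `(log x)^k` normalisation. -/
theorem weightedDensity_mul_log_pow_tendsto
    (hS₁ : RieszSingularLimit 1) (hS₂ : ∀ k : ℕ, 2 ≤ k → RieszSingularLimit k)
    {k : ℕ} {f : Fin k → ℤ[X]} (hf : IsBatemanHornSystem f) {u : ℝ} (hu : 2 < u) :
    ∃ M : ℝ, Tendsto (fun x : ℕ =>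
      (∑ d ∈ tupleSet (sieveBound f u x) (level (thetaKU k u) x),
          (∏ i, (ArithmeticFunction.moebius (d i) : ℝ)) * rieszWeight (level (thetaKU k u) x) d *
            (((rhoTuple f d : ℕ) : ℝ) / ((∏ i, d i : ℕ) : ℝ))) * Real.log x ^ k) atTop (𝓝 M) := by
  set θ : ℝ := thetaKU k u with hθdef
  have hθ : 0 < θ := thetaKU_pos k (by linarith)
  have hvac := eventually_level_lt_sieveBound hf hu
  have hD2 : ∀ᶠ x : ℕ in atTop, 2 ≤ level θ x := (tendsto_level_atTop hθ).eventually_ge_atTop 2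
  rcases Nat.eq_zero_or_pos k with hk | hk
  · subst hk
    refine ⟨1, tendsto_const_nhds.congr' ?_⟩
    filter_upwards [hvac, hD2] with x hx hD
    rw [pow_zero, mul_one, weightedDensity_fin_zero f (by omega)]
  · -- `k ≥ 1`: main term `= (log x/log D)^k · R_f(D)`
    have hRS : RieszSingularLimit k := by
      rcases Nat.lt_or_ge k 2 with hk2 | hk2
      · have : k = 1 := by omega
        subst this; exact hS₁
      · exact hS₂ k hk2
    obtain ⟨M, hM⟩ := hRS f hf
    refine ⟨(1 / θ) ^ k * M, ?_⟩
    have hlim := ((tendsto_log_div_log_level_pow hθ k).mul (hM.comp (tendsto_level_atTop hθ)))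
    refine hlim.congr' ?_
    filter_upwards [hvac, hD2, eventually_ge_atTop 2] with x hx hD hx2
    have hlogD : Real.log (level θ x) ≠ 0 := by
      have : (1 : ℝ) < (level θ x : ℕ) := by exact_mod_cast hD
      exact (Real.log_pos this).ne'
    rw [weightedDensity_eq_rieszSingularSum_div f hx, ← hθdef]
    simp only [Function.comp_apply]
    rw [div_pow]
    field_simp

/-- **S2 from S2b₁ + S2b₂ + S2c (v5).**  The log-smoothed level-`x^{θ_{k,u}}` Type-I part converges
after normalisation. -/
theorem typeISmoothLimit_of_parts
    (hS₁ : RieszSingularLimit 1) (hS₂ : ∀ k : ℕ, 2 ≤ k → RieszSingularLimit k) :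
    TypeISmoothLimit := by
  intro k f hf u hu
  obtain ⟨M, hM⟩ := weightedDensity_mul_log_pow_tendsto hS₁ hS₂ hf hu
  refine ⟨M, ?_⟩
  obtain ⟨n₀, hn₀⟩ := IncrementAnchoring.SieveBand.exists_forall_eval_pos hf
  refine hM.congr_dist ?_
  have hrem := tendsto_remainder_zero k n₀ hu
  refine squeeze_zero' (Eventually.of_forall fun x => dist_nonneg) ?_ hrem
  filter_upwards [eventually_ge_atTop 1] with x hx
  have hx0 : (0 : ℝ) < x := by exact_mod_cast hx
  rw [Real.dist_eq, typeISmoothNorm]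
  set θ : ℝ := thetaKU k u
  set W := ∑ d ∈ tupleSet (sieveBound f u x) (level θ x),
      (∏ i, (ArithmeticFunction.moebius (d i) : ℝ)) * rieszWeight (level θ x) d *
        (((rhoTuple f d : ℕ) : ℝ) / ((∏ i, d i : ℕ) : ℝ)) with hW
  have hb := abs_typeISmooth_sub_le f u x hn₀
  rw [← hW] at hb
  have hlog : 0 ≤ Real.log x ^ k := pow_nonneg (Real.log_nonneg (by exact_mod_cast hx)) k
  calc |W * Real.log x ^ k - typeISmooth f u x * Real.log x ^ k / (x : ℝ)|
      = |typeISmooth f u x - (x : ℝ) * W| * Real.log x ^ k / (x : ℝ) := by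
        rw [show W * Real.log x ^ k - typeISmooth f u x * Real.log x ^ k / (x : ℝ) =
            -((typeISmooth f u x - (x : ℝ) * W) * Real.log x ^ k / (x : ℝ)) by field_simp; ring]
        rw [abs_neg, abs_div, abs_mul, abs_of_nonneg hlog, abs_of_pos hx0]
    _ ≤ ((level θ x : ℕ) : ℝ) ^ k * ((n₀ : ℝ) + (level θ x : ℕ)) * Real.log x ^ k / (x : ℝ) := by
        gcongr

/-! ### §4c (v7) `RieszSingularLimit k` for EVERY `k` from S2b₂α + S2b₂β (sorry-free)

`R_f(D) = Σ_{n ≤ D} A_f(n)/n · log(D/n)^k` (regroup the tuples by their product: `jointCoeff`,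
`rieszSingularSum_eq_sum_jointCoeff`); `A_f = B_f ⋆ E` (S2b₂β); hence
`R_f(D) = Σ_{m ≤ D} E(m)/m · G(D/m)` with `G(y) = Σ_{l ≤ y} B_f(l)/l · log(y/l)^k`
(`sum_Icc_sum_divisorsAntidiagonal`), `G → M` by S2b₂α at `aᵢ = μρ_{fᵢ}` (hypotheses (H1)/(H2)
are the tree's Landau theorems `exists_tendsto_logRieszMean_moebius_rootCount`,
`abs_sum_moebius_rootCount_div_le`), `G` is bounded, and Tannery's theorem
(`tendsto_tsum_of_dominated_convergence`, majorant `K|E(m)|/m`) gives `R_f(D) → M·Σ_m E(m)/m`. -/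

/-- The joint coefficient `A_f(n) = Σ_{dᵢ ∣ n, ∏dᵢ = n} μ(d⃗)·#{r < n : ∀ i, dᵢ ∣ fᵢ(r)}` (the
left side of S2b₂β). -/
def jointCoeff {k : ℕ} (f : Fin k → ℤ[X]) (n : ℕ) : ℝ :=
  ∑ d ∈ (Fintype.piFinset fun _ : Fin k => n.divisors) with (∏ i, d i) = n,
    (∏ i, (ArithmeticFunction.moebius (d i) : ℝ)) *
      ((#((range n).filter (fun r : ℕ => ∀ i, ((d i : ℕ) : ℤ) ∣ (f i).eval (r : ℤ))) : ℕ) : ℝ)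

/-- The single-coordinate arithmetic function `μρ_g : n ↦ μ(n)ρ_g(n)` (zero at `0`;
`ρ_g = polyRootCountMod ![g]`), as in S2b₂β. -/
def muRho (g : ℤ[X]) : ArithmeticFunction ℝ :=
  toArithmeticFunction (fun m : ℕ => (ArithmeticFunction.moebius m : ℝ) * (polyRootCountMod ![g] m : ℝ))

theorem muRho_apply {g : ℤ[X]} {n : ℕ} (hn : n ≠ 0) :
    muRho g n = (ArithmeticFunction.moebius n : ℝ) * (polyRootCountMod ![g] n : ℝ) := by
  simp [muRho, toArithmeticFunction, hn]

/-- **R1 (regrouping).** `R_f(D) = Σ_{1 ≤ n ≤ D} A_f(n)/n · log(D/n)^k`. -/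
theorem rieszSingularSum_eq_sum_jointCoeff {k : ℕ} (f : Fin k → ℤ[X]) (D : ℕ) :
    rieszSingularSum f D = ∑ n ∈ Icc 1 D, jointCoeff f n / n * Real.log ((D : ℝ) / n) ^ k := by
  unfold rieszSingularSum tupleSet₀
  rw [← Finset.sum_fiberwise_of_maps_to (g := fun d : Fin k → ℕ => ∏ i, d i) (t := Icc 1 D)
    (fun d hd => by
      rw [Finset.mem_filter, Fintype.mem_piFinset] at hd
      exact mem_Icc.mpr ⟨Finset.one_le_prod' fun i _ => (mem_Icc.mp (hd.1 i)).1, hd.2⟩)]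
  refine Finset.sum_congr rfl fun n hn => ?_
  obtain ⟨hn1, hnD⟩ := mem_Icc.mp hn
  have hn0 : n ≠ 0 := by omega
  have hfib : ((Fintype.piFinset fun _ : Fin k => Icc 1 D).filter
        (fun d : Fin k → ℕ => (∏ i, d i) ≤ D)).filter (fun d => (∏ i, d i) = n) =
      (Fintype.piFinset fun _ : Fin k => n.divisors).filter (fun d => (∏ i, d i) = n) := by
    ext d
    simp only [mem_filter, Fintype.mem_piFinset, mem_Icc, Nat.mem_divisors]
    constructor
    · rintro ⟨⟨_, _⟩, hprod⟩
      exact ⟨fun i => ⟨hprod ▸ Finset.dvd_prod_of_mem d (mem_univ i), hn0⟩, hprod⟩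
    · rintro ⟨hd, hprod⟩
      refine ⟨⟨fun i => ⟨Nat.pos_of_dvd_of_pos (hd i).1 (by omega), ?_⟩, hprod.le.trans hnD⟩, hprod⟩
      exact (Nat.le_of_dvd (by omega) (hd i).1).trans hnD
  rw [hfib, jointCoeff, Finset.sum_div, Finset.sum_mul]
  refine Finset.sum_congr rfl fun d hd => ?_
  have hprod : (∏ i, d i) = n := (mem_filter.mp hd).2
  unfold densityTerm rhoTuple
  rw [show (∏ i, ((d i : ℕ) : ℝ)) = (n : ℝ) by rw [← Nat.cast_prod, hprod], hprod]

/-- **R2 (reordering a Dirichlet convolution under a cut-off).**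
`Σ_{1 ≤ n ≤ D} Σ_{lm = n} φ(l,m) = Σ_{1 ≤ m ≤ D} Σ_{1 ≤ l ≤ D/m} φ(l,m)`. -/
theorem sum_Icc_sum_divisorsAntidiagonal (φ : ℕ → ℕ → ℝ) (D : ℕ) :
    ∑ n ∈ Icc 1 D, ∑ p ∈ n.divisorsAntidiagonal, φ p.1 p.2 =
      ∑ m ∈ Icc 1 D, ∑ l ∈ Icc 1 (D / m), φ l m := by
  rw [Finset.sum_sigma', Finset.sum_sigma']
  refine Finset.sum_bij' (fun x _ => ⟨x.2.2, x.2.1⟩) (fun y _ => ⟨y.2 * y.1, (y.2, y.1)⟩)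
    ?_ ?_ ?_ ?_ ?_
  · rintro ⟨n, ⟨l, m⟩⟩ hx
    simp only [Finset.mem_sigma, mem_Icc, Nat.mem_divisorsAntidiagonal] at hx
    obtain ⟨⟨_, hnD⟩, hlm, hn0⟩ := hx
    subst hlm
    have hm : 0 < m := Nat.pos_of_ne_zero fun h => hn0 (by simp [h])
    have hl : 0 < l := Nat.pos_of_ne_zero fun h => hn0 (by simp [h])
    exact Finset.mem_sigma.mpr ⟨mem_Icc.mpr ⟨hm, le_trans (Nat.le_mul_of_pos_left m hl) hnD⟩,
      mem_Icc.mpr ⟨hl, (Nat.le_div_iff_mul_le hm).mpr hnD⟩⟩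
  · rintro ⟨m, l⟩ hy
    simp only [Finset.mem_sigma, mem_Icc] at hy
    obtain ⟨⟨hm1, hmD⟩, hl1, hlD⟩ := hy
    have hlm : l * m ≤ D := (Nat.le_div_iff_mul_le hm1).mp hlD
    have hne : l * m ≠ 0 := Nat.mul_ne_zero (by omega) (by omega)
    exact Finset.mem_sigma.mpr ⟨mem_Icc.mpr ⟨Nat.one_le_iff_ne_zero.mpr hne, hlm⟩,
      Nat.mem_divisorsAntidiagonal.mpr ⟨rfl, hne⟩⟩
  · rintro ⟨n, ⟨l, m⟩⟩ hx
    simp only [Finset.mem_sigma, mem_Icc, Nat.mem_divisorsAntidiagonal] at hx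
    obtain ⟨_, hlm, _⟩ := hx
    simp [hlm]
  · rintro ⟨m, l⟩ _
    rfl
  · rintro ⟨n, ⟨l, m⟩⟩ _
    rfl

/-- **R3 (Tannery).** If `Σ|E(m)|/m < ∞`, `G → M` at `+∞` and `|G| ≤ K`, then
`Σ_{1 ≤ m ≤ D} E(m)/m · G(D/m) → M · Σ_m E(m)/m` (`D → ∞` through `ℕ`). -/
theorem tendsto_sum_div_mul_apply_div {E : ℕ → ℝ} (hE : Summable fun m : ℕ => |E m| / m)
    {G : ℝ → ℝ} {M K : ℝ} (hG : Tendsto G atTop (𝓝 M)) (hK : ∀ y, |G y| ≤ K) :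
    Tendsto (fun D : ℕ => ∑ m ∈ Icc 1 D, E m / m * G ((D : ℝ) / m)) atTop
      (𝓝 (M * ∑' m, E m / m)) := by
  have hK0 : 0 ≤ K := (abs_nonneg _).trans (hK 0)
  -- the summands, extended by zero
  set F : ℕ → ℕ → ℝ := fun D m => if m ∈ Icc 1 D then E m / m * G ((D : ℝ) / m) else 0 with hF
  have hsumF : ∀ D : ℕ, ∑ m ∈ Icc 1 D, E m / m * G ((D : ℝ) / m) = ∑' m, F D m := by
    intro D
    rw [tsum_eq_sum (s := Icc 1 D) (fun m hm => by simp only [hF]; rw [if_neg hm])]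
    exact Finset.sum_congr rfl fun m hm => by simp only [hF]; rw [if_pos hm]
  simp_rw [hsumF]
  have hlim : M * ∑' m, E m / m = ∑' m, E m / m * M := by rw [tsum_mul_right, mul_comm]
  rw [hlim]
  refine tendsto_tsum_of_dominated_convergence (bound := fun m => |E m| / m * K) (hE.mul_right K)
    ?_ ?_
  · intro m
    rcases Nat.eq_zero_or_pos m with rfl | hm
    · have : ∀ D, F D 0 = 0 := fun D => by simp [hF]
      simp only [this, Nat.cast_zero, div_zero, zero_mul]
      exact tendsto_const_nhds
    · have hev : ∀ᶠ D : ℕ in atTop, F D m = E m / m * G ((D : ℝ) / m) := by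
        filter_upwards [eventually_ge_atTop m] with D hD
        simp [hF, hD, Nat.one_le_iff_ne_zero.mpr hm.ne']
      refine Tendsto.congr' (EventuallyEq.symm hev) ?_
      refine Tendsto.const_mul _ (hG.comp ?_)
      exact Tendsto.atTop_div_const (by exact_mod_cast hm) tendsto_natCast_atTop_atTop
  · refine Eventually.of_forall fun D m => ?_
    simp only [hF]
    split_ifs with hm
    · rw [Real.norm_eq_abs, abs_mul, abs_div, Nat.abs_cast]
      exact mul_le_mul_of_nonneg_left (hK _) (by positivity)
    · rw [norm_zero]; positivity

/-- A convergent order-`k` Riesz mean of an arithmetic function is bounded on `ℝ`. -/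
theorem exists_bound_of_tendsto_rieszMean (B : ArithmeticFunction ℝ) (k : ℕ) {M : ℝ}
    (hG : Tendsto (fun y : ℝ => ∑ l ∈ Icc 1 ⌊y⌋₊, B l / l * Real.log (y / l) ^ k) atTop (𝓝 M)) :
    ∃ K : ℝ, ∀ y : ℝ, |∑ l ∈ Icc 1 ⌊y⌋₊, B l / l * Real.log (y / l) ^ k| ≤ K := by
  have hev : ∀ᶠ y : ℝ in atTop, |∑ l ∈ Icc 1 ⌊y⌋₊, B l / l * Real.log (y / l) ^ k - M| < 1 := by
    have := (Metric.tendsto_nhds.mp hG) 1 one_pos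
    simpa only [Real.dist_eq] using this
  obtain ⟨Y, hY⟩ := (hev.and (eventually_ge_atTop 1)).exists_forall_of_atTop
  -- `Y' = max Y 1`; on `[Y', ∞)` within `1` of `M`; below `Y'` the crude bound
  set Y' : ℝ := max Y 1 with hY'
  set K₀ : ℝ := (∑ l ∈ Icc 1 ⌊Y'⌋₊, |B l| / l) * Real.log Y' ^ k with hK₀
  refine ⟨max (|M| + 1) K₀, fun y => ?_⟩
  rcases le_or_gt Y' y with hy | hy
  · have h := (hY y ((le_max_left _ _).trans hy)).1
    have : |∑ l ∈ Icc 1 ⌊y⌋₊, B l / l * Real.log (y / l) ^ k| ≤ |M| + 1 := by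
      have := abs_sub_abs_le_abs_sub (∑ l ∈ Icc 1 ⌊y⌋₊, B l / l * Real.log (y / l) ^ k) M
      linarith
    exact this.trans (le_max_left _ _)
  · refine le_trans ?_ (le_max_right _ _)
    rcases lt_or_ge y 1 with hy1 | hy1
    · have : ⌊y⌋₊ = 0 := Nat.floor_eq_zero.mpr hy1
      rw [this]
      simp only [show Icc 1 0 = (∅ : Finset ℕ) by rfl, Finset.sum_empty, abs_zero, hK₀]
      have h1 : (1 : ℝ) ≤ Y' := le_max_right _ _
      exact mul_nonneg (Finset.sum_nonneg fun l _ => by positivity) (pow_nonneg (Real.log_nonneg h1) k)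
    · -- `1 ≤ y < Y'`
      have hyY : ⌊y⌋₊ ≤ ⌊Y'⌋₊ := Nat.floor_le_floor hy.le
      have hlogY : 0 ≤ Real.log Y' := Real.log_nonneg (le_max_right _ _)
      calc |∑ l ∈ Icc 1 ⌊y⌋₊, B l / l * Real.log (y / l) ^ k|
          ≤ ∑ l ∈ Icc 1 ⌊y⌋₊, |B l / l * Real.log (y / l) ^ k| := Finset.abs_sum_le_sum_abs _ _
        _ ≤ ∑ l ∈ Icc 1 ⌊y⌋₊, |B l| / l * Real.log Y' ^ k := by
            refine Finset.sum_le_sum fun l hl => ?_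
            obtain ⟨hl1, hly⟩ := mem_Icc.mp hl
            have hl0 : (0 : ℝ) < l := by exact_mod_cast hl1
            have hly' : (l : ℝ) ≤ y := (Nat.cast_le.mpr hly).trans (Nat.floor_le (by linarith))
            have hlog0 : 0 ≤ Real.log (y / l) := Real.log_nonneg ((one_le_div hl0).mpr hly')
            have hlogle : Real.log (y / l) ≤ Real.log Y' := by
              refine Real.log_le_log (by positivity) ?_
              rw [div_le_iff₀ hl0]
              have : (1 : ℝ) ≤ l := by exact_mod_cast hl1
              nlinarith
            rw [abs_mul, abs_div, Nat.abs_cast, abs_pow, abs_of_nonneg hlog0]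
            exact mul_le_mul_of_nonneg_left (pow_le_pow_left₀ hlog0 hlogle k) (by positivity)
        _ ≤ ∑ l ∈ Icc 1 ⌊Y'⌋₊, |B l| / l * Real.log Y' ^ k := by
            refine Finset.sum_le_sum_of_subset_of_nonneg (Finset.Icc_subset_Icc_right hyY) ?_
            intro l _ _
            positivity
        _ = K₀ := by rw [hK₀, Finset.sum_mul]

/-- **`RieszSingularLimit k` for every `k`, from S2b₂α + S2b₂β** (the v6 stub S2b₂ as a theorem of
the v7 stubs; also re-derives S2b₁). -/
theorem rieszSingularLimit_of_factorisation
    (hα : ∀ (k : ℕ) (a : Fin k → ArithmeticFunction ℝ),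
      (∀ i, ∃ L : ℝ, Tendsto (fun x : ℝ => ∑ n ∈ Icc 1 ⌊x⌋₊, a i n / n * Real.log (x / n))
        atTop (𝓝 L)) →
      (∀ i, ∃ C : ℝ, ∀ x : ℝ, 2 ≤ x → |∑ n ∈ Icc 1 ⌊x⌋₊, a i n / n| ≤ C / Real.log x ^ 2) →
      ∃ M : ℝ, Tendsto (fun x : ℝ => ∑ n ∈ Icc 1 ⌊x⌋₊, (∏ i, a i) n / n * Real.log (x / n) ^ k)
        atTop (𝓝 M))
    (hβ : ∀ (k : ℕ) (f : Fin k → ℤ[X]), IsBatemanHornSystem f →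
      ∃ E : ℕ → ℝ, Summable (fun m : ℕ => |E m| / m) ∧
        ∀ n : ℕ, (∑ d ∈ (Fintype.piFinset fun _ : Fin k => n.divisors) with (∏ i, d i) = n,
            (∏ i, (ArithmeticFunction.moebius (d i) : ℝ)) *
              ((#((range n).filter
                  (fun r : ℕ => ∀ i, ((d i : ℕ) : ℤ) ∣ (f i).eval (r : ℤ))) : ℕ) : ℝ)) =
          ∑ p ∈ n.divisorsAntidiagonal,
            (∏ i, toArithmeticFunction (fun m : ℕ => (ArithmeticFunction.moebius m : ℝ) *
                (polyRootCountMod ![f i] m : ℝ))) p.1 * E p.2)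
    (k : ℕ) : RieszSingularLimit k := by
  intro f hf
  obtain ⟨E, hEsum, hEid⟩ := hβ k f hf
  -- S2b₂α at `aᵢ = μρ_{fᵢ}`; (H1), (H2) from the tree (Landau)
  have H1 : ∀ i, ∃ L : ℝ, Tendsto (fun x : ℝ => ∑ n ∈ Icc 1 ⌊x⌋₊,
      muRho (f i) n / n * Real.log (x / n)) atTop (𝓝 L) := by
    intro i
    obtain ⟨L, hL⟩ := Literature.NumberTheory.LFunctions.exists_tendsto_logRieszMean_moebius_rootCount
      (hf.irreducible i) (hf.natDegree_pos i)
    refine ⟨L, hL.congr fun x => Finset.sum_congr rfl fun n hn => ?_⟩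
    rw [muRho_apply (by have := (mem_Icc.mp hn).1; omega)]
  have H2 : ∀ i, ∃ C : ℝ, ∀ x : ℝ, 2 ≤ x →
      |∑ n ∈ Icc 1 ⌊x⌋₊, muRho (f i) n / n| ≤ C / Real.log x ^ 2 := by
    intro i
    obtain ⟨C, hC⟩ := Literature.NumberTheory.LFunctions.abs_sum_moebius_rootCount_div_le
      (hf.irreducible i) (hf.natDegree_pos i)
    refine ⟨C, fun x hx => ?_⟩
    have h := hC x hx
    rwa [Finset.sum_congr rfl fun n hn => by
      rw [muRho_apply (by have := (mem_Icc.mp hn).1; omega)]]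
  obtain ⟨M, hM⟩ := hα k (fun i => muRho (f i)) H1 H2
  set B : ArithmeticFunction ℝ := ∏ i, muRho (f i) with hB
  set G : ℝ → ℝ := fun y => ∑ l ∈ Icc 1 ⌊y⌋₊, B l / l * Real.log (y / l) ^ k with hGdef
  have hG : Tendsto G atTop (𝓝 M) := hM
  obtain ⟨K, hK⟩ := exists_bound_of_tendsto_rieszMean B k hM
  refine ⟨M * ∑' m, E m / m, ?_⟩
  have hT := tendsto_sum_div_mul_apply_div hEsum hG hK
  refine hT.congr fun D => ?_
  -- the identity `R_f(D) = Σ_{m ≤ D} E(m)/m · G(D/m)`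
  rw [rieszSingularSum_eq_sum_jointCoeff]
  have hA : ∀ n ∈ Icc 1 D, jointCoeff f n = ∑ p ∈ n.divisorsAntidiagonal, B p.1 * E p.2 := by
    intro n _
    rw [jointCoeff, hEid n]
    simp only [hB, muRho]
  symm
  calc ∑ n ∈ Icc 1 D, jointCoeff f n / n * Real.log ((D : ℝ) / n) ^ k
      = ∑ n ∈ Icc 1 D, ∑ p ∈ n.divisorsAntidiagonal,
          E p.2 / p.2 * (B p.1 / p.1 * Real.log ((D : ℝ) / p.2 / p.1) ^ k) := by
        refine Finset.sum_congr rfl fun n hn => ?_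
        rw [hA n hn, Finset.sum_div, Finset.sum_mul]
        refine Finset.sum_congr rfl fun p hp => ?_
        obtain ⟨hpn, hn0⟩ := Nat.mem_divisorsAntidiagonal.mp hp
        have h1 : (p.1 : ℝ) ≠ 0 := by exact_mod_cast (Nat.mul_ne_zero_iff.mp (hpn ▸ hn0)).1
        have h2 : (p.2 : ℝ) ≠ 0 := by exact_mod_cast (Nat.mul_ne_zero_iff.mp (hpn ▸ hn0)).2
        rw [← hpn, Nat.cast_mul, div_div, mul_comm (p.2 : ℝ)]
        field_simp
    _ = ∑ m ∈ Icc 1 D, ∑ l ∈ Icc 1 (D / m),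
          E m / m * (B l / l * Real.log ((D : ℝ) / m / l) ^ k) :=
        sum_Icc_sum_divisorsAntidiagonal (fun l m => E m / m * (B l / l * Real.log ((D : ℝ) / m / l) ^ k)) D
    _ = ∑ m ∈ Icc 1 D, E m / m * G ((D : ℝ) / m) := by
        refine Finset.sum_congr rfl fun m hm => ?_
        rw [← Finset.mul_sum, hGdef]
        simp only
        rw [Nat.floor_div_natCast, Nat.floor_natCast]

/-- **v6's S2b₂ `stub_rieszSingularSeries` is now a THEOREM** of the v7 stubs S2b₂α/β
(registered signature verbatim). -/
theorem rieszSingularSeries_of_stubs :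
    ∀ (k : ℕ) (f : Fin k → ℤ[X]), IsBatemanHornSystem f → 2 ≤ k →
      ∃ M : ℝ, Tendsto (fun D : ℕ =>
        ∑ d ∈ (Fintype.piFinset fun _ : Fin k => Icc 1 D) with (∏ i, d i) ≤ D,
          (∏ i, (ArithmeticFunction.moebius (d i) : ℝ)) *
              ((#((range (∏ i, d i)).filter
                  (fun r : ℕ => ∀ i, ((d i : ℕ) : ℤ) ∣ (f i).eval (r : ℤ))) : ℕ) : ℝ) /
              (∏ i, ((d i : ℕ) : ℝ)) *
            Real.log ((D : ℝ) / ((∏ i, d i : ℕ) : ℝ)) ^ k) atTop (𝓝 M) :=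
  rieszSingularSeries_iff.mp fun k f hf _ =>
    rieszSingularLimit_of_factorisation stub_rieszProductLimit stub_singularSeriesFactorisation k f hf

/-- S2 (`TypeISmoothLimit`) from the stubs: S2b₁ (landed, `k = 1`) and S2b₂α/β (`k ≥ 2`, via
`rieszSingularLimit_of_factorisation`), through the v5 reduction `typeISmoothLimit_of_parts`. -/
theorem typeISmoothLimit_of_stubs : TypeISmoothLimit :=
  typeISmoothLimit_of_parts (rieszSingularLimit_one stub_rieszMeanRootMoebius)
    (fun k _ => rieszSingularLimit_of_factorisation stub_rieszProductLimit
      stub_singularSeriesFactorisation k)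
/-- **THE COMPOSITION.**  `RoughValueLaw` BY NAME from the stubs (sorry only inside `stub_*`). -/
theorem RoughValueLaw_of : RoughValueLaw :=
  roughValueLaw_iff.mpr (systemRoughValueLaw_of_parts typeISmoothLimit_of_stubs stub_residual)

/-- The residual statement IS the pinned crux (instantiated honesty certificate). -/
theorem residual_iff_pinnedLaw' :
    Residual ↔ ∀ (k : ℕ) (f : Fin k → ℤ[X]), IsBatemanHornSystem f → PinnedLaw f :=
  residual_iff_pinnedLaw typeISmoothLimit_of_stubs

/-! ### §4d (v7) The crux pins its own constant; hence `Residual ↔ RoughValueLaw` (sorry-free glue)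

Given the crux for `f` and an inline-Buchstab `ω`, the PROVED support item `SieveCalibration`
(`Summit.Parity.BatemanHorn.Theorems.sieveCalibration_proof`) applied to `L(u) = A(uω(u))^k`, de
Bruijn's limit `ω(u) → e^{−γ}` (`harman2007_buchstabOmega_tendsto_holds`) and uniqueness of
Buchstab's function (`IncrementAnchoring.OmegaFacts.eq_buchstabOmega`, landed p74566) force
`A = C(f)/∏ deg fᵢ = bhA f`.  So the crux implies the PINNED law, and with `residual_iff_pinnedLaw'`
the residual S3 is equivalent to the crux itself (modulo S2). -/

/-- **The crux pins its constant**: `RoughValueLaw → PinnedLaw f` for every Bateman–Horn system. -/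
theorem pinnedLaw_of_roughValueLaw (hR : RoughValueLaw) {k : ℕ} {f : Fin k → ℤ[X]}
    (hf : IsBatemanHornSystem f) : PinnedLaw f := by
  intro ω hω u hu
  obtain ⟨A, hA⟩ := hR k f hf ω hω
  -- `SieveCalibration` with `L u = A (u ω u)^k`
  have hSC := Summit.Parity.BatemanHorn.Theorems.sieveCalibration_proof k f hf
    (fun u => A * (u * ω u) ^ k) ⟨3, fun v hv => hA v (by linarith)⟩
  -- `ω = buchstabOmega` on `[1, ∞)`, and `buchstabOmega → e^{−γ}`
  have hωeq : ∀ t : ℝ, 1 ≤ t → ω t = buchstabOmega t := fun t ht =>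
    IncrementAnchoring.OmegaFacts.eq_buchstabOmega hω.1 hω.2.1 hω.2.2 ht
  have hlim := harman2007_buchstabOmega_tendsto_holds
  unfold harman2007_buchstabOmega_tendsto at hlim
  have hSC' : Tendsto (fun v : ℝ => A * (v * ω v) ^ k / v ^ k) atTop
      (𝓝 (A * Real.exp (-Real.eulerMascheroniConstant) ^ k)) := by
    have h1 := (hlim.pow k).const_mul A
    refine h1.congr' ?_
    filter_upwards [eventually_gt_atTop 1] with v hv
    rw [hωeq v hv.le, mul_pow]
    have hv0 : v ≠ 0 := by linarith
    field_simp
  have hAeq : A = bhA f := by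
    have huniq := tendsto_nhds_unique hSC' hSC
    have he : Real.exp (-((k : ℝ) * Real.eulerMascheroniConstant)) =
        Real.exp (-Real.eulerMascheroniConstant) ^ k := by
      rw [← Real.exp_nat_mul]
      congr 1
      ring
    rw [he] at huniq
    unfold bhA
    exact mul_right_cancel₀ (pow_ne_zero k (Real.exp_pos _).ne') huniq
  rw [← hAeq]
  exact hA u hu

/-- **Honesty certificate, sharp form (v7)**: modulo S2 (`TypeISmoothLimit`, from the landed
S2b₁/S2c and the v7 stubs S2b₂α/β) the residual S3 is EQUIVALENT TO THE CRUX ITSELF — a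
`promote-stub` of S3 hands back exactly `RoughValueLaw`, nothing weaker, nothing stronger. -/
theorem residual_iff_roughValueLaw : Residual ↔ RoughValueLaw :=
  ⟨fun h₃ => roughValueLaw_iff.mpr (systemRoughValueLaw_of_parts typeISmoothLimit_of_stubs h₃),
    fun hR => residual_iff_pinnedLaw'.mpr fun _ _ hf => pinnedLaw_of_roughValueLaw hR hf⟩


/-! ## §5 Beyond `x` (sorry-free): the level push moves the residual to `DeepTailBeyond` -/

/-- **S1 + the lever AT `f` + the pinned law ⟹ DeepTailBeyond f** for a quadratic `f`: after the
level push, the sharp deep tail beyond `x` is what remains of the pinned law. -/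
theorem deepTailBeyond_of_pinnedLaw_at (h₁ : FriableDecomposition) (f : ℤ[X])
    (h₄ : TypeILevelPushAt f) (hlaw : PinnedLaw ![f]) : DeepTailBeyond f := by
  intro ω hω
  obtain ⟨u₀, hu₀, H⟩ := h₄ ω hω
  refine ⟨u₀, hu₀, fun u hu => ?_⟩
  obtain ⟨δ₀, hδ₀, Hδ⟩ := H u hu
  refine ⟨δ₀, hδ₀, fun δ hδ hδle => ?_⟩
  have hu2 : 2 < u := by linarith
  have hP := Hδ δ hδ hδle
  have hlim := (hlaw ω hω u hu2).sub hP
  have hval : bhA ![f] * (u * ω u) ^ 1 - bhA ![f] * (u * ω ((1 + δ) * u / 2)) =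
      bhA ![f] * (u * ω u - u * ω ((1 + δ) * u / 2)) := by ring
  rw [hval] at hlim
  refine hlim.congr fun x => ?_
  have e := roughNorm_eq h₁ ![f] u (1 + δ) x
  linarith

/-- **S1 + S4 (general lever) + the pinned law ⟹ DeepTailBeyond** for a BH quadratic. -/
theorem deepTailBeyond_of_pinnedLaw (h₁ : FriableDecomposition) (h₄ : TypeILevelPush)
    (f : ℤ[X]) (hf : IsBatemanHornSystem ![f]) (hdeg : f.natDegree = 2)
    (hlaw : PinnedLaw ![f]) : DeepTailBeyond f :=
  deepTailBeyond_of_pinnedLaw_at h₁ f (h₄ f hf hdeg) hlaw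

/-- **S1 + the lever AT `f` + DeepTailBeyond f ⟹ the crux's conclusion for `![f]` on the rungs
`u ≥ u₀`**, with the forced constant `A = C(f)/2`: after the level push, the ε-parity statement
`DeepTailBeyond f` is ALL that the quadratic rungs `u ≥ u₀` of the crux require. -/
theorem largeDepthRoughValueLaw_of_parts_at (h₁ : FriableDecomposition) (f : ℤ[X])
    (h₄ : TypeILevelPushAt f) (h₅ : DeepTailBeyond f) : LargeDepthRoughValueLaw ![f] := by
  intro ω hω
  obtain ⟨u₀, hu₀, H⟩ := h₄ ω hω
  obtain ⟨u₁, hu₁, H'⟩ := h₅ ω hω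
  refine ⟨max u₀ u₁, fun u hu => ?_⟩
  obtain ⟨δ₀, hδ₀, Hδ⟩ := H u ((le_max_left _ _).trans hu)
  obtain ⟨δ₁, hδ₁, Hδ'⟩ := H' u ((le_max_right _ _).trans hu)
  set δ : ℝ := min δ₀ δ₁ with hδdef
  have hδ : 0 < δ := lt_min hδ₀ hδ₁
  have hP := Hδ δ hδ (min_le_left _ _)
  have hT := Hδ' δ hδ (min_le_right _ _)
  have hlim := hP.add hT
  have hval : bhA ![f] * (u * ω ((1 + δ) * u / 2)) +
      bhA ![f] * (u * ω u - u * ω ((1 + δ) * u / 2)) = bhA ![f] * (u * ω u) ^ 1 := by ring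
  rw [hval] at hlim
  refine hlim.congr fun x => ?_
  exact (roughNorm_eq h₁ ![f] u (1 + δ) x).symm

/-- The same with the general lever S4 as hypothesis. -/
theorem largeDepthRoughValueLaw_of_parts (h₁ : FriableDecomposition) (h₄ : TypeILevelPush)
    (f : ℤ[X]) (hf : IsBatemanHornSystem ![f]) (hdeg : f.natDegree = 2) (h₅ : DeepTailBeyond f) :
    LargeDepthRoughValueLaw ![f] :=
  largeDepthRoughValueLaw_of_parts_at h₁ f (h₄ f hf hdeg) h₅

/-- The pinned constant for a single polynomial: `bhA ![f] = C(f)/deg f` (`= C(f)/2` for a quadratic). -/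
theorem bhA_single (f : ℤ[X]) : bhA ![f] = batemanHornConst ![f] / (f.natDegree : ℝ) := by
  simp [bhA]

/-- Instantiated with the stubs: every BH quadratic has `DeepTailBeyond` modulo S1, S3 (which
gives the pinned law, `residual_iff_pinnedLaw'`) and the GENERAL lever `TypeILevelPush`
(a hypothesis here; v7 registers only its `X² + 1` slice). -/
theorem deepTailBeyond_quadratic (h₄ : TypeILevelPush) (f : ℤ[X]) (hf : IsBatemanHornSystem ![f])
    (hdeg : f.natDegree = 2) : DeepTailBeyond f :=
  deepTailBeyond_of_pinnedLaw friableDecomposition_of_stub h₄ f hf hdeg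
    ((residual_iff_pinnedLaw'.mp stub_residual) 1 ![f] hf)

/-- … and conversely `DeepTailBeyond f` gives its rungs `u ≥ u₀` modulo S1 + the lever only
(no S2, no S3). -/
theorem largeDepthRoughValueLaw_quadratic (h₄ : TypeILevelPush) (f : ℤ[X])
    (hf : IsBatemanHornSystem ![f]) (hdeg : f.natDegree = 2) (h₅ : DeepTailBeyond f) :
    LargeDepthRoughValueLaw ![f] :=
  largeDepthRoughValueLaw_of_parts friableDecomposition_of_stub h₄ f hf hdeg h₅

/-- The `n² + 1` instance: from the (v11: de-registered, hypothesis) S4-slice `TypeILevelPushAt (X²+1)`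
and S1, S3: `DeepTailBeyond (X²+1)`. -/
theorem deepTailBeyond_X_sq_add_one (h₄ : TypeILevelPushAt (X ^ 2 + 1 : ℤ[X])) :
    DeepTailBeyond (X ^ 2 + 1 : ℤ[X]) :=
  deepTailBeyond_of_pinnedLaw_at friableDecomposition_of_stub _ h₄
    ((residual_iff_pinnedLaw'.mp stub_residual) 1 _ isBatemanHornSystem_X_sq_add_one)

/-- The `n² + 1` rungs `u ≥ u₀` with `A = 𝔖/2` (`hardyLittlewoodEConst/2`) follow from S1, the
S4-slice `TypeILevelPushAt (X²+1)` (v11: hypothesis) and the ε-parity statement `DeepTailBeyond (X²+1)`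
(no S2, no S3). -/
theorem largeDepthRoughValueLaw_X_sq_add_one (h₄ : TypeILevelPushAt (X ^ 2 + 1 : ℤ[X]))
    (h₅ : DeepTailBeyond (X ^ 2 + 1 : ℤ[X])) :
    LargeDepthRoughValueLaw ![(X ^ 2 + 1 : ℤ[X])] :=
  largeDepthRoughValueLaw_of_parts_at friableDecomposition_of_stub _ h₄ h₅

/-! ### §5b (v12) The `n² + 1` instances with the lever PROVED -/

/-- **v12:** `DeepTailBeyond (X²+1)` from S1 (PROVED), the lever (PROVED) and S3 (`stub_residual`,
≡ the crux) — i.e. the crux gives the ε-parity statement for `n² + 1`. -/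
theorem deepTailBeyond_X_sq_add_one' : DeepTailBeyond (X ^ 2 + 1 : ℤ[X]) :=
  deepTailBeyond_X_sq_add_one typeILevelPushAt_X_sq_add_one

/-- **v12: the `n² + 1` rungs `u ≥ u₀` of the crux need ONLY the ε-parity statement** — with S1 and the
lever PROVED, `DeepTailBeyond (X²+1)` ALONE gives `LargeDepthRoughValueLaw ![X²+1]` (`A = 𝔖/2`);
sorry-free. -/
theorem largeDepthRoughValueLaw_X_sq_add_one' (h₅ : DeepTailBeyond (X ^ 2 + 1 : ℤ[X])) :
    LargeDepthRoughValueLaw ![(X ^ 2 + 1 : ℤ[X])] :=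
  largeDepthRoughValueLaw_X_sq_add_one typeILevelPushAt_X_sq_add_one h₅

/-- **v12:** conversely the pinned law for `n² + 1` gives `DeepTailBeyond (X²+1)` (S1 + the lever, both
PROVED; sorry-free, no S3): the sharp deep tail BEYOND `x` is the exact open content of the `n²+1` rungs. -/
theorem deepTailBeyond_X_sq_add_one_of_pinnedLaw (hlaw : PinnedLaw ![(X ^ 2 + 1 : ℤ[X])]) :
    DeepTailBeyond (X ^ 2 + 1 : ℤ[X]) :=
  deepTailBeyond_of_pinnedLaw_at friableDecomposition_of_stub _ typeILevelPushAt_X_sq_add_one hlaw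

end Summit.Parity.BatemanHorn.Cruxes.RoughValueLaw.FriableDeepTail
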